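import Summits.Parity.BatemanHorn.Theses.RoughValueTransport
import Literature.NumberTheory.Sieve.BombieriAsymptoticSieveSmoothPart
import Literature.NumberTheory.Sieve.AletheiaZomleferFukshanskyGarcia2020Applications
import Summits.Parity.BatemanHorn.Theorems.RoughValueTransportRoughValueLawSieveBand

/-!
# Line `friable-deep-tail` — checked skeleton for the crux `RoughValueLaw`
(item stmt-Parity-11390, route `RoughValueTransport`, sub-problem Parity/BatemanHorn)

Crux (by name: `Summit.Parity.BatemanHorn.Theses.RoughValueTransport.RoughValueLaw`): for every
Bateman–Horn system `f = (f₀,…,f_{k−1})` and every `ω` with Buchstab's characterisation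
(`ω = 1/u` on `[1,2]`, continuous on `[1,∞)`, `(uω)' = ω(u−1)` for `u > 2`) there is `A` with
`Φ_f(x,u)·(log x)^k/x → A·(uω(u))^k` for every `u > 2`, where
`Φ_f(x,u) = #{1 ≤ n ≤ x : ∀ i, fᵢ(n) > 0 and no prime p < ⌈x^{deg fᵢ/u}⌉ divides fᵢ(n)}`.

## The line (idea card `Ideas/friable-deep-tail.md`; triage TRIAGE-r1-{1,2,3}: pass ×3)

Lever: split Legendre's identity COORDINATE-WISE AT A LEVEL `D`.  With `sᵢ(n)` the
`Bᵢ`-friable part of `fᵢ(n)` (`Bᵢ = ⌈x^{deg fᵢ/u}⌉`; tree `smoothPart`), roughness of all values is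
`∏ᵢ [sᵢ(n) = 1] = Σ_{dᵢ ∣ sᵢ(n)} ∏ᵢ μ(dᵢ) = typeIKernel_D(s(n)) + deepKernel_D(s(n))`, the two
`f`-INDEPENDENT signed kernels collecting the divisor tuples with `∏ dᵢ ≤ D`, resp. `> D`
(S1 `stub_friableDecomposition`; `deepKernel_D(s) = 0` unless `∏ sᵢ > D` — PROVED here,
`deepKernel_eq_zero_of_prod_le`, so the deep tail lives on the `n` whose values have an abnormally
large friable part, Tenenbaum's set, `deepSum_eq_sum_filter`).  Hence, at level `D = x^θ`,
`Φ_f = typeISum(θ) + deepSum(θ)` and the crux splits into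
* the TYPE-I LAW `typeISum(θ)·(log x)^k/x → M_f(u,θ)` — for `θ < 1` every modulus is below the
  number of terms and the statement is a sharply-truncated sieve sum of dimension `k`, of
  prime-ideal-theorem strength (TRIAGE-r1-1/2/3: for `k = 1`, `deg f = d`,
  `M_f(u,θ) = (C(f)/d)·u·ω(θu/d)·1[θu/d > 1]`, i.e. `λ(s) = e^γ ω(s)`, NOT "→ 1"; numerics
  `lambda_1e8.log`, kit j007750) — S2 `stub_typeILimit` (existence, all systems);
* the DEEP-TAIL LAW `deepSum(θ)·(log x)^k/x → (C(f)/∏ deg fᵢ)·(uω(u))^k − M_f(u,θ)` — the declared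
  RESIDUAL S3 `stub_deepTailComplement` (open; parity-complete; for `k = 1` the target is
  `(C/d)·u·(ω(u) − ω(θu/d))`: −24 %, +6 %, −1 % of the rung of `n²+1` at `u = 3, 4, 6`, `θ = 0.95`);
* the LEVEL PUSH (the card's Transfer (b), the genuinely new provable content): for ONE QUADRATIC
  `f` and `u ≥ u₀` the n-wise Type-I law persists BEYOND `x`, `typeISum(1+δ)·log x/x →
  (C(f)/2)·u·ω((1+δ)u/2)` for all `0 < δ ≤ δ₀(u)` — because a `x^{2/u}`-friable modulus factors at
  ANY prescribed scale (densely divisible), so the signed remainder `Σ_{x^{1−η}<d≤x^{1+δ}, P⁺(d)<z}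
  μ(d) r_d(x)` is a sum of admissible bilinear forms: Iwaniec 1978 Cor. of Prop. 1 (level `x^{16/15}`
  for `n²+1`, PROVED in the tree as `Iwaniec1978.proposition1_corollary_holds`; `u₀ = 31`),
  Merikoski 2022 Prop. 4 (i)+(ii) (`n²+1`, `u₀ = 6`), de la Bretèche–Drappeau / Iwaniec–Lemke Oliver
  dispersion for general quadratics (tree predicate `Iwaniec1978.proposition1G`) — S4
  `stub_typeILevelPush`.  Consistency check of the profile: at `θ = 2` (level = size of the values)
  `typeISum = Φ_f` identically and `(C/2)·u·ω(2u/2)` IS the crux's prediction with `A = C(f)/2`;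
  so for a quadratic the crux ⟺ "the level law survives from `θ = 1+δ₀` to `θ = 2`", and the deep
  tail beyond `x` — the signed count over the `n ≤ x` whose value has a `x^{2/u}`-friable divisor
  `> x^{1+δ}` (support density `ϑ(6, 3(1+δ)) ∈ [0.2 %, 1.2 %]` of the `n ≤ x`, size `|T| ≈ 0.5 %` of
  the rung, at `u = 6`) — is where the parity of the crux lives
  (`DeepTailBeyond`, PROVED here to follow from S1–S4 and to imply the crux's conclusion for `![f]`
  on the rungs `u ≥ u₀` with the forced constant `A = C(f)/2`).

## Reshape v2/v3 (line lead prover-line-stmt-Parity-11390-b-0, 2026-08-16) — 6 registered stubs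

* S1 and the new S2a/S2c are stated over TREE vocabulary only (`smoothPart`, `Nat.divisors`,
  `Fintype.piFinset`, `ArithmeticFunction.moebius`, `Nat.primeFactors`, plain `Finset.filter`
  counts), i.e. with this file's §0 abbreviations UNFOLDED, so that each lands as a pure-proof
  `--supports` file without waiting for a reviewed Defs file; the §0 defs stay as this skeleton's
  reading vocabulary and the bridges are definitional (`friableDecomposition_iff` etc. by `Iff.rfl`).
* S2 `stub_typeILimit` is WEAKENED to the single level exponent the composition uses,
  `θ = θ_{k,u} = 1/((k+3)u)` (`thetaKU`; v2/v3 used `1/(k+3)`), and split one layer down into S2a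
  `stub_typeISumSwap` (exact double-counting identity, M), S2c `stub_congruenceCount` (periodic
  counting of the joint congruence classes, S/M) and S2b `stub_truncatedSingularSeries` (v4: the
  hyperbolically truncated singular series `S_f(D) = Σ_{∏dᵢ ≤ D} μ(d⃗)ρ_f(d⃗)/∏dᵢ` is
  `o((log D)^{-k})`, `k ≥ 1` — the prime-ideal-theorem-strength content, stated f-intrinsically
  with its limit `0` identified, L for `k = 1` from PROVED tree material, XL for `k ≥ 2`; held by
  the lead); at `θ_{k,u}` every remainder is absorbed by the TRIVIAL bounds `|T| ≤ D^k`,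
  `ρ(d⃗) ≤ ∏dᵢ ≤ D`, `D^{k+1} ≤ x^{1/2}`, and the friability condition on the tuples is VACUOUS
  (`D < x^{1/u} ≤ Bᵢ`), so no divisor-sum stub and no Buchstab iteration is needed.
  v3 (same session): the reduction `S2 ⇐ S2a + S2b + S2c` is kernel-checked here
  (`typeILimit_of_parts`, §4b), so S2 `stub_typeILimit` is NO LONGER A STUB — 6 registered stubs.
* S3 (residual, open) and S4 (lever, XL) are verbatim.

## Stubs (v1: 4) and composition

* S1 `stub_friableDecomposition` — the identity (Legendre per coordinate, split at `∏ dᵢ ≤ D`). [M,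
  provable now]
* S2 `stub_typeILimit` — the level-`x^θ` (`θ < 1`) Type-I part of `Φ_f(x,u)` has a limit after the
  crux's normalisation, every BH system, every `u > 2`. [L for k = 1 / XL in general; PIT-strength]
* S3 `stub_deepTailComplement` — RESIDUAL (open): the deep tail converges to the complement
  `(C(f)/∏deg fᵢ)(uω(u))^k − M`. [open-problem; ≡ crux ∧ (A = C(f)/∏deg) modulo S1+S2 —
  `deepTailComplement_of_pinnedLaw` / `systemRoughValueLaw_of_parts`, both PROVED here]
* S4 `stub_typeILevelPush` — THE LEVER: n-wise Type-I law beyond `x` for one BH quadratic, `u ≥ u₀`.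
  [XL; provable now for `n²+1` from the tree's Iwaniec corollary + PIT for `ℚ(i)`] HARDEST CLAIMED.

Composition (sorry-free, kernel-checked): `RoughValueLaw_of : RoughValueLaw` from S1, S2, S3
(`systemRoughValueLaw_of_parts`, `roughValueLaw_iff`); beyond `x`: `deepTailBeyond_of_parts`
(S1–S4 ⇒ `DeepTailBeyond f`), `largeDepthRoughValueLaw_of_parts` (S1 + S4 + `DeepTailBeyond f` ⇒
the crux's conclusion for `![f]`, `u ≥ u₀`, `A = C(f)/2`), `deepTailComplement_of_pinnedLaw`
(crux with the expected constant + S1 + S2 ⇒ S3: the residual is EXACTLY the crux's non-Type-I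
content, no weakening and no strengthening beyond pinning `A`).

## Disproof.lean (cdisprove, 4 updates to 2026-08-15T22:52Z; body cited through its evidence notes —
not mounted in this jail, nothing landed under `Theorems/RoughValueLaw/Negative/`) — what is honoured

`roughValueLaw_false_without_nonAssociated` ((X,X)): S2/S3 carry `IsBatemanHornSystem f` and USE
`pairwise_not_associated` — for (X,X) the Type-I main term has dimension 1 against the `(log x)²`
normalisation and diverges; `…_false_without_irreducible` ((X,X²)): S2 (the density `g(d⃗)` of the
Type-I sum is computed from irreducible, non-associated coordinates: common roots only at resultant
primes); `…_false_without_noFixedPrimeDivisor` with `conclusion_of_not_hasNoFixedPrimeDivisor`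
(A = 0 allowed): consistent — a fixed prime divisor kills the Euler factor of the Type-I main term
and `C(f) = 0`; `…_false_without_omegaInit/omegaDDE`: S3 and S4 quantify over `ω` with the FULL
inline predicate (`IsBuchstab`, verbatim) and their targets name `ω(u)`, `ω((1+δ)u/2)`; continuity
clause redundant (`isBuchstab_iff`) — harmless, kept verbatim; `not_roughValueLawUniform`: no stub is
uniform in `u` (S4's `δ₀` depends on `u`, and `x → ∞` first everywhere); rungs `tendsto_ratio_X`
(A = 1) and `conclusion_twoXAddOne` (A = 2 = C/deg) agree with the pinned constant
`bhA f = C(f)/∏ deg fᵢ` of S3/S4; `eventually_cardFactors_le_two`: S4 claims rungs `u ≥ u₀ ≥ 6`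
only, never `u < 3`.  Negatives index (`ledger negatives --problem Parity`): 3 GHL items, none on
rough values; no stub is an instance of a refuted statement.
-/

noncomputable section

open Filter Finset Polynomial
open scoped Topology BigOperators

namespace Summit.Parity.BatemanHorn.Cruxes.RoughValueLaw.FriableDeepTail

open Literature.NumberTheory.Sieve
open Summit.Parity.BatemanHorn.Theses.RoughValueTransport (RoughValueLaw)

/-! ## §0 Objects (all over existing declarations: `smoothPart`, `ArithmeticFunction.moebius`,
`Nat.divisors`, `Fintype.piFinset`, `IsBatemanHornSystem`, `batemanHornConst`) -/

/-- Buchstab's function, characterised INLINE exactly as in the crux (rev 4 cone repair): `ω = 1/u`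
on `[1,2]`, continuous on `[1,∞)`, `(uω(u))' = ω(u−1)` for `u > 2`.  Unique solution: the tree's
`buchstabOmega` (existence/uniqueness machine-checked in the item's evidence OmegaUnique.lean). -/
def IsBuchstab (ω : ℝ → ℝ) : Prop :=
  (∀ u : ℝ, 1 ≤ u → u ≤ 2 → ω u = u⁻¹) ∧ ContinuousOn ω (Set.Ici 1) ∧
    (∀ u : ℝ, 2 < u → HasDerivAt (fun t : ℝ => t * ω t) (ω (u - 1)) u)

/-- Sifting bound of coordinate `i` at height `x`, depth `u`: `Bᵢ = ⌈x^{deg fᵢ/u}⌉₊` (the crux sifts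
the primes `p < Bᵢ`, i.e. `p ∈ range Bᵢ`). -/
def sieveBound {k : ℕ} (f : Fin k → ℤ[X]) (u : ℝ) (x : ℕ) (i : Fin k) : ℕ :=
  ⌈(x : ℝ) ^ (((f i).natDegree : ℝ) / u)⌉₊

/-- The level `D = ⌊x^θ⌋₊` of the Type-I / deep split. -/
def level (θ : ℝ) (x : ℕ) : ℕ := ⌊(x : ℝ) ^ θ⌋₊

/-- The crux's count `Φ_f(x,u)` (verbatim sub-term of `RoughValueLaw`). -/
def roughCount {k : ℕ} (f : Fin k → ℤ[X]) (u : ℝ) (x : ℕ) : ℕ :=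
  #((Icc 1 x).filter (fun n : ℕ => ∀ i, 0 < (f i).eval (n : ℤ) ∧
    ∀ p ∈ range ⌈(x : ℝ) ^ (((f i).natDegree : ℝ) / u)⌉₊, p.Prime → ¬ ((p : ℤ) ∣ (f i).eval (n : ℤ))))

/-- Level-`D` **Type-I kernel** on a vector `s = (s₀,…,s_{k−1})` of positive integers:
`Σ_{d : dᵢ ∣ sᵢ, ∏ dᵢ ≤ D} ∏ᵢ μ(dᵢ)` — an `f`-independent signed combinatorial function. -/
def typeIKernel {k : ℕ} (D : ℕ) (s : Fin k → ℕ) : ℤ :=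
  ∑ d ∈ (Fintype.piFinset fun i => (s i).divisors) with (∏ i, d i) ≤ D,
    ∏ i, (ArithmeticFunction.moebius (d i) : ℤ)

/-- Level-`D` **deep kernel** `h_D(s) = Σ_{d : dᵢ ∣ sᵢ, ∏ dᵢ > D} ∏ᵢ μ(dᵢ)` — the sharp-truncation
remainder of the Legendre/Eratosthenes sieve written value-wise (TRIAGE-r1-2 (1)); `f`-independent;
vanishes unless `∏ sᵢ > D` (`deepKernel_eq_zero_of_prod_le`).  For `k = 1`:
`h_D(s) = −Σ_{d ∣ s, d ≤ D} μ(d)` when `s > D`, a truncated Möbius divisor sum. -/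
def deepKernel {k : ℕ} (D : ℕ) (s : Fin k → ℕ) : ℤ :=
  ∑ d ∈ (Fintype.piFinset fun i => (s i).divisors) with D < ∏ i, d i,
    ∏ i, (ArithmeticFunction.moebius (d i) : ℤ)

/-- The vector of friable parts of the values at `n`: `sᵢ(n) =` the `Bᵢ`-friable part of `fᵢ(n)`
(tree `smoothPart B N = ∏_{p ∣ N, p < B} p^{v_p(N)}`; `= 1` for `N = 0`). -/
def friableParts {k : ℕ} (f : Fin k → ℤ[X]) (B : Fin k → ℕ) (n : ℕ) : Fin k → ℕ :=
  fun i => smoothPart (B i) ((f i).eval (n : ℤ)).toNat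

/-- The `1 ≤ n ≤ x` with every value positive (the crux's positivity clause; cofinite for a BH system). -/
def posRange {k : ℕ} (f : Fin k → ℤ[X]) (x : ℕ) : Finset ℕ :=
  (Icc 1 x).filter (fun n : ℕ => ∀ i, 0 < (f i).eval (n : ℤ))

/-- The level-`x^θ` **Type-I part** of `Φ_f(x,u)`: `Σ_{n} typeIKernel_{⌊x^θ⌋}(s(n))`
(`= Σ_{∏dᵢ ≤ x^θ, dᵢ Bᵢ-friable} ∏μ(dᵢ)·#{n : dᵢ ∣ fᵢ(n) ∀ i}` after swapping sums). -/
def typeISum {k : ℕ} (f : Fin k → ℤ[X]) (u θ : ℝ) (x : ℕ) : ℤ :=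
  ∑ n ∈ posRange f x, typeIKernel (level θ x) (friableParts f (sieveBound f u x) n)

/-- The level-`x^θ` **deep tail** of `Φ_f(x,u)`: `Σ_{n} deepKernel_{⌊x^θ⌋}(s(n))`, supported on the
`n` with `∏ᵢ sᵢ(n) > x^θ` (`deepSum_eq_sum_filter`). -/
def deepSum {k : ℕ} (f : Fin k → ℤ[X]) (u θ : ℝ) (x : ℕ) : ℤ :=
  ∑ n ∈ posRange f x, deepKernel (level θ x) (friableParts f (sieveBound f u x) n)

/-- The crux's normalisation of `Φ_f`: `Φ_f(x,u)·(log x)^k/x`. -/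
def roughNorm {k : ℕ} (f : Fin k → ℤ[X]) (u : ℝ) (x : ℕ) : ℝ :=
  (roughCount f u x : ℝ) * Real.log x ^ k / x

/-- Normalised Type-I part `typeISum·(log x)^k/x`. -/
def typeINorm {k : ℕ} (f : Fin k → ℤ[X]) (u θ : ℝ) (x : ℕ) : ℝ :=
  (typeISum f u θ x : ℝ) * Real.log x ^ k / x

/-- Normalised deep tail `deepSum·(log x)^k/x`. -/
def deepNorm {k : ℕ} (f : Fin k → ℤ[X]) (u θ : ℝ) (x : ℕ) : ℝ :=
  (deepSum f u θ x : ℝ) * Real.log x ^ k / x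

/-- The expected (and, modulo the route's provable-now support item SieveCalibration, forced)
constant of the crux: `A = C(f)/∏ᵢ deg fᵢ` (`C(f) = batemanHornConst f`; `= 1` for the empty
system, `= 1` for `(X)`, `= 2` for `(2X+1)` — the two rungs machine-checked in Disproof.lean). -/
def bhA {k : ℕ} (f : Fin k → ℤ[X]) : ℝ :=
  batemanHornConst f / ∏ i, ((f i).natDegree : ℝ)


/-! ### §0b Vocabulary of the v2–v4 reshape (swapped Type-I sum) -/

/-- The level exponent the composition actually uses (v4): `θ = θ_{k,u} = 1/((k+3)u)`.  Two effects:
(i) every remainder of the swapped Type-I sum is trivially `o(x/(log x)^k)`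
(`D^{k+1} ≤ x^{1/2}`); (ii) `D = ⌊x^θ⌋ < x^{1/u} ≤ ⌈x^{deg fᵢ/u}⌉`, so EVERY divisor tuple of the
Type-I sum is automatically friable and the density sum is the plain truncated singular series of
`f` (`truncSingularSum`), whose `(log)^k`-normalised limit is `0` for `k ≥ 1` (S2b). -/
def thetaKU (k : ℕ) (u : ℝ) : ℝ := 1 / (((k : ℝ) + 3) * u)

/-- The divisor tuples of the level-`D` Type-I sum with sifting bounds `B`:
`T(B,D) = {d⃗ : 1 ≤ dᵢ ≤ D, ∏ dᵢ ≤ D, every prime factor of dᵢ is < Bᵢ}`. -/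
def tupleSet {k : ℕ} (B : Fin k → ℕ) (D : ℕ) : Finset (Fin k → ℕ) :=
  (Fintype.piFinset fun _ : Fin k => Icc 1 D).filter
    (fun d => (∏ i, d i) ≤ D ∧ ∀ i, ∀ p ∈ (d i).primeFactors, p < B i)

/-- The same tuples WITHOUT the friability condition: `T⁰(D) = {d⃗ : 1 ≤ dᵢ ≤ D, ∏ dᵢ ≤ D}`. -/
def tupleSet₀ (k : ℕ) (D : ℕ) : Finset (Fin k → ℕ) :=
  (Fintype.piFinset fun _ : Fin k => Icc 1 D).filter (fun d => (∏ i, d i) ≤ D)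

/-- Joint congruence count with the crux's positivity clause:
`N⁺_f(d⃗; x) = #{1 ≤ n ≤ x : ∀ i, fᵢ(n) > 0 ∧ dᵢ ∣ fᵢ(n)}`. -/
def congCountPos {k : ℕ} (f : Fin k → ℤ[X]) (d : Fin k → ℕ) (x : ℕ) : ℕ :=
  #((Icc 1 x).filter (fun n : ℕ => (∀ i, 0 < (f i).eval (n : ℤ)) ∧
    ∀ i, ((d i : ℕ) : ℤ) ∣ (f i).eval (n : ℤ)))

/-- Joint congruence count `N_f(d⃗; x) = #{1 ≤ n ≤ x : ∀ i, dᵢ ∣ fᵢ(n)}` (no positivity clause;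
`∏ dᵢ`-periodic in `n`). -/
def congCount {k : ℕ} (f : Fin k → ℤ[X]) (d : Fin k → ℕ) (x : ℕ) : ℕ :=
  #((Icc 1 x).filter (fun n : ℕ => ∀ i, ((d i : ℕ) : ℤ) ∣ (f i).eval (n : ℤ)))

/-- Joint local root count `ρ_f(d⃗) = #{r mod ∏dᵢ : ∀ i, dᵢ ∣ fᵢ(r)}` (for a single coordinate and
modulus `d` this is the tree's `polyRootCountMod ![f] d`). -/
def rhoTuple {k : ℕ} (f : Fin k → ℤ[X]) (d : Fin k → ℕ) : ℕ :=
  #((range (∏ i, d i)).filter (fun r : ℕ => ∀ i, ((d i : ℕ) : ℤ) ∣ (f i).eval (r : ℤ)))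

/-- The density summand `μ(d⃗)·ρ_f(d⃗)/∏dᵢ` (reals). -/
def densityTerm {k : ℕ} (f : Fin k → ℤ[X]) (d : Fin k → ℕ) : ℝ :=
  (∏ i, (ArithmeticFunction.moebius (d i) : ℝ)) * (rhoTuple f d : ℝ) / (∏ i, ((d i : ℕ) : ℝ))

/-- The density sum of the swapped Type-I part with sifting bounds `B`, level `D`:
`Σ_{d⃗ ∈ T(B,D)} μ(d⃗)ρ_f(d⃗)/∏dᵢ`. -/
def densitySum {k : ℕ} (f : Fin k → ℤ[X]) (B : Fin k → ℕ) (D : ℕ) : ℝ :=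
  ∑ d ∈ tupleSet B D, densityTerm f d

/-- The **truncated singular series** of the system: `S_f(D) = Σ_{d⃗ ∈ T⁰(D)} μ(d⃗)ρ_f(d⃗)/∏dᵢ`
(hyperbolic truncation `∏ dᵢ ≤ D`, no friability).  Its complete version is the Euler product
`∏_p (1 − ν_f(p)/p) = 0` (`k ≥ 1`); S2b says the truncation error is `o((log D)^{-k})`. -/
def truncSingularSum {k : ℕ} (f : Fin k → ℤ[X]) (D : ℕ) : ℝ :=
  ∑ d ∈ tupleSet₀ k D, densityTerm f d

/-! ## §1 Named statements of the line (the stubs restate S1–S4 verbatim; `DeepTailBeyond`,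
`SystemRoughValueLaw`, `LargeDepthRoughValueLaw` are conclusions of the PROVED transfers) -/

/-- **FriableDecomposition** (= S1): the crux's count, for arbitrary sifting bounds `B` and level
`D`, equals Type-I part plus deep tail, value-wise. -/
def FriableDecomposition : Prop :=
  ∀ (k : ℕ) (f : Fin k → ℤ[X]) (B : Fin k → ℕ) (D x : ℕ),
    ((#((Icc 1 x).filter (fun n : ℕ => ∀ i, 0 < (f i).eval (n : ℤ) ∧
        ∀ p ∈ range (B i), p.Prime → ¬ ((p : ℤ) ∣ (f i).eval (n : ℤ)))) : ℕ) : ℤ) =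
      ∑ n ∈ posRange f x, (typeIKernel D (friableParts f B n) + deepKernel D (friableParts f B n))

/-- **TypeILimitBelow** (= S2, v4: at the level exponent `θ_{k,u} = 1/((k+3)u)` the composition
uses): the level-`x^θ` Type-I part converges after normalisation (to `0` for `k ≥ 1`, to `1` for
`k = 0`; `typeILimit_of_parts`). -/
def TypeILimitBelow : Prop :=
  ∀ (k : ℕ) (f : Fin k → ℤ[X]), IsBatemanHornSystem f → ∀ u : ℝ, 2 < u →
    ∃ M : ℝ, Tendsto (typeINorm f u (thetaKU k u)) atTop (𝓝 M)

/-- **DeepTailComplement** (= S3, the RESIDUAL): whatever the Type-I limit `M` is, the deep tail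
converges to `(C(f)/∏deg fᵢ)·(uω(u))^k − M`. -/
def DeepTailComplement : Prop :=
  ∀ (k : ℕ) (f : Fin k → ℤ[X]), IsBatemanHornSystem f → ∀ ω : ℝ → ℝ, IsBuchstab ω →
    ∀ u θ : ℝ, 2 < u → 0 < θ → θ < 1 → ∀ M : ℝ, Tendsto (typeINorm f u θ) atTop (𝓝 M) →
      Tendsto (deepNorm f u θ) atTop (𝓝 (bhA f * (u * ω u) ^ k - M))

/-- **TypeILevelPush** (= S4, the LEVER): for one Bateman–Horn QUADRATIC `f` and `u ≥ u₀` the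
n-wise Type-I law holds at every level `x^{1+δ}`, `0 < δ ≤ δ₀(u)`, with the explicit limit
`(C(f)/2)·u·ω((1+δ)u/2)`. -/
def TypeILevelPush : Prop :=
  ∀ f : ℤ[X], IsBatemanHornSystem ![f] → f.natDegree = 2 → ∀ ω : ℝ → ℝ, IsBuchstab ω →
    ∃ u₀ : ℝ, 2 < u₀ ∧ ∀ u : ℝ, u₀ ≤ u → ∃ δ₀ : ℝ, 0 < δ₀ ∧ ∀ δ : ℝ, 0 < δ → δ ≤ δ₀ →
      Tendsto (typeINorm ![f] u (1 + δ)) atTop (𝓝 (bhA ![f] * (u * ω ((1 + δ) * u / 2))))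

/-- **DeepTailBeyond f** — the residual AFTER the level push (not a stub; PROVED below to follow from
S1–S4 and to imply the crux's conclusion for `![f]` on `u ≥ u₀`): for a quadratic `f`, the deep tail
beyond `x` — the signed count `Σ h_{x^{1+δ}}(s(n))` over the `n ≤ x` whose value has a
`x^{2/u}`-friable part `> x^{1+δ}` — tends to `(C(f)/2)·u·(ω(u) − ω((1+δ)u/2))` after normalisation. -/
def DeepTailBeyond (f : ℤ[X]) : Prop :=
  ∀ ω : ℝ → ℝ, IsBuchstab ω →
    ∃ u₀ : ℝ, 2 < u₀ ∧ ∀ u : ℝ, u₀ ≤ u → ∃ δ₀ : ℝ, 0 < δ₀ ∧ ∀ δ : ℝ, 0 < δ → δ ≤ δ₀ →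
      Tendsto (deepNorm ![f] u (1 + δ)) atTop
        (𝓝 (bhA ![f] * (u * ω u - u * ω ((1 + δ) * u / 2))))

/-- The crux's conclusion for ONE system (verbatim body of `RoughValueLaw` after `IsBatemanHornSystem f →`). -/
def SystemRoughValueLaw (k : ℕ) (f : Fin k → ℤ[X]) : Prop :=
  ∀ ω : ℝ → ℝ, IsBuchstab ω → ∃ A : ℝ, ∀ u : ℝ, 2 < u →
    Tendsto (fun x : ℕ => (((Finset.Icc 1 x).filter (fun n : ℕ => ∀ i, 0 < (f i).eval (n : ℤ) ∧
      ∀ p ∈ Finset.range ⌈(x : ℝ) ^ (((f i).natDegree : ℝ) / u)⌉₊, p.Prime →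
        ¬ ((p : ℤ) ∣ (f i).eval (n : ℤ)))).card : ℝ) * Real.log x ^ k / (x : ℝ))
      atTop (𝓝 (A * (u * ω u) ^ k))

/-- The crux's conclusion for one system ON THE RUNGS `u ≥ u₀`, with the pinned constant
`A = C(f)/∏ deg fᵢ` (a sub-statement of the crux for that system, up to the value of `A`). -/
def LargeDepthRoughValueLaw {k : ℕ} (f : Fin k → ℤ[X]) : Prop :=
  ∀ ω : ℝ → ℝ, IsBuchstab ω → ∃ u₀ : ℝ, ∀ u : ℝ, u₀ ≤ u →
    Tendsto (roughNorm f u) atTop (𝓝 (bhA f * (u * ω u) ^ k))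

/-- Read-back: the crux is `∀ systems, SystemRoughValueLaw` (definitional, incl. the inline `ω`). -/
theorem roughValueLaw_iff :
    RoughValueLaw ↔ ∀ (k : ℕ) (f : Fin k → ℤ[X]), IsBatemanHornSystem f → SystemRoughValueLaw k f :=
  Iff.rfl

/-- `0 < θ_{k,u}` for `u > 0`. -/
theorem thetaKU_pos (k : ℕ) {u : ℝ} (hu : 0 < u) : 0 < thetaKU k u := by
  unfold thetaKU; positivity

/-- `θ_{k,u} < 1/u` for `u > 0`. -/
theorem thetaKU_lt_inv (k : ℕ) {u : ℝ} (hu : 0 < u) : thetaKU k u < 1 / u := by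
  unfold thetaKU
  rw [div_lt_div_iff_of_pos_left one_pos (by positivity) hu]
  have hk : (0 : ℝ) ≤ k := Nat.cast_nonneg k
  nlinarith

/-- `θ_{k,u} < 1` for `u > 2`. -/
theorem thetaKU_lt_one (k : ℕ) {u : ℝ} (hu : 2 < u) : thetaKU k u < 1 := by
  have h := thetaKU_lt_inv k (show 0 < u by linarith)
  have : 1 / u < 1 := by rw [div_lt_one (by linarith)]; linarith
  linarith

/-- `(k+1)·θ_{k,u} ≤ 1/2` for `u > 2` (the remainder exponent). -/
theorem thetaKU_mul_succ_le (k : ℕ) {u : ℝ} (hu : 2 < u) : ((k : ℝ) + 1) * thetaKU k u ≤ 1 / 2 := by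
  unfold thetaKU
  have hk : (0 : ℝ) ≤ k := Nat.cast_nonneg k
  have hpos : (0 : ℝ) < ((k : ℝ) + 3) * u := by positivity
  rw [← mul_div_assoc, mul_one, div_le_iff₀ hpos]
  nlinarith

/-! ## §2 The stubs (`sorry` lives ONLY here) -/

/-- **S1 — FriableDecomposition (the identity; size M, provable now; v2: stated with the §0
abbreviations `posRange`/`typeIKernel`/`deepKernel`/`friableParts` UNFOLDED — tree vocabulary only;
`friableDecomposition_iff` below is the definitional bridge).**  For every family `f`,
sifting bounds `B`, level `D` and height `x`:
`#{1 ≤ n ≤ x : ∀ i, fᵢ(n) > 0 ∧ no prime p < Bᵢ divides fᵢ(n)} = Σ_{n ∈ posRange}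
(typeIKernel_D + deepKernel_D)(s(n))`, `sᵢ(n) = smoothPart Bᵢ (fᵢ(n))`.
Proof plan: (1) for `N = fᵢ(n) > 0`, "no prime `p < B` divides `N`" ⟺ `smoothPart B N = 1`
(`factorization_smoothPart`, `prime_dvd_smoothPart_iff`, `Int.natCast_dvd` with `Int.toNat_of_nonneg`);
(2) `Σ_{d ∣ s} μ(d) = [s = 1]` for `s ≥ 1` (Mathlib `ArithmeticFunction.sum_moebius_eq_ite` /
`coe_zeta_mul_moebius`), so `∏ᵢ [sᵢ = 1] = Σ_{d ∈ piFinset (divisors ∘ s)} ∏ᵢ μ(dᵢ)`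
(`Finset.prod_univ_sum`); (3) split the `piFinset` sum by `∏ dᵢ ≤ D` / `D < ∏ dᵢ`
(`Finset.sum_filter_add_sum_filter_not`); (4) `card = Σ_{n ∈ posRange} ∏ᵢ[sᵢ(n) = 1]`
(`Finset.card_filter`, `Finset.sum_boole`).  Edges: `k = 0` (both sides `x`), `Bᵢ ≤ 1`, `D = 0` fine
(checked on paper by all three triagers).  Leans on: `smoothPart`, `smoothPart_ne_zero`,
`factorization_smoothPart`, `prime_dvd_smoothPart_iff`, `Nat.divisors`, `Fintype.piFinset`,
`ArithmeticFunction.moebius`.  Uses no hypothesis on `f` (pure combinatorics). -/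
theorem stub_friableDecomposition :
    ∀ (k : ℕ) (f : Fin k → ℤ[X]) (B : Fin k → ℕ) (D x : ℕ),
      ((#((Icc 1 x).filter (fun n : ℕ => ∀ i, 0 < (f i).eval (n : ℤ) ∧
          ∀ p ∈ range (B i), p.Prime → ¬ ((p : ℤ) ∣ (f i).eval (n : ℤ)))) : ℕ) : ℤ) =
        ∑ n ∈ (Icc 1 x).filter (fun n : ℕ => ∀ i, 0 < (f i).eval (n : ℤ)),
          ((∑ d ∈ (Fintype.piFinset fun i =>
                (smoothPart (B i) ((f i).eval (n : ℤ)).toNat).divisors) with (∏ i, d i) ≤ D,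
              ∏ i, (ArithmeticFunction.moebius (d i) : ℤ)) +
           (∑ d ∈ (Fintype.piFinset fun i =>
                (smoothPart (B i) ((f i).eval (n : ℤ)).toNat).divisors) with D < ∏ i, d i,
              ∏ i, (ArithmeticFunction.moebius (d i) : ℤ))) := by
  sorry

/-- **S2a — TypeISumSwap (v2; the exact double-counting identity; size M, provable now; tree
vocabulary only).**  For every family `f`, sifting bounds `B`, level `D`, height `x`:
`Σ_{n ∈ posRange} typeIKernel_D(s(n)) = Σ_{d⃗ ∈ T(B,D)} (∏ᵢ μ(dᵢ)) · N⁺_f(d⃗; x)`, where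
`T(B,D) = {d⃗ ∈ [1,D]^k : ∏dᵢ ≤ D, all prime factors of dᵢ are < Bᵢ}` (`tupleSet B D`) and
`N⁺_f(d⃗; x) = #{1 ≤ n ≤ x : ∀ i, fᵢ(n) > 0 ∧ dᵢ ∣ fᵢ(n)}` (`congCountPos f d x`).
Proof plan: `Finset.sum_comm'`/`Finset.sum_sigma'` style swap; the pointwise equivalence, for `n`
with every `fᵢ(n) > 0` (so `Nᵢ := (fᵢ(n)).toNat ≠ 0`, `(Nᵢ : ℤ) = fᵢ(n)` by `Int.toNat_of_nonneg`):
`d⃗ ∈ piFinset (divisors ∘ s(n)) ∧ ∏dᵢ ≤ D  ⟺  d⃗ ∈ T(B,D) ∧ ∀ i, dᵢ ∣ Nᵢ`, from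
`Nat.mem_divisors`, `smoothPart_ne_zero`, and `d ∣ smoothPart B N ↔ (d ∣ N ∧ ∀ p ∈ d.primeFactors,
p < B)` for `N ≠ 0` (via `Nat.factorization_le_iff_dvd` + `factorization_smoothPart`, or
`smoothPart_dvd` + `Nat.Coprime.dvd_of_dvd_mul_right` with `coprime_smoothPart_div` /
`smoothPart_mem_smoothNumbers`); `1 ≤ dᵢ ≤ D` from `dᵢ ∣ Nᵢ ≠ 0` and `∏ dⱼ ≤ D` with all `dⱼ ≥ 1`
(`Finset.single_le_prod'`); `(dᵢ : ℤ) ∣ fᵢ(n) ↔ dᵢ ∣ Nᵢ` (`Int.natCast_dvd_natCast` after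
rewriting `fᵢ(n) = (Nᵢ : ℤ)`); then `Finset.sum_mul`/`Finset.card_eq_sum_ones`,
`Finset.sum_filter`, `Finset.sum_comm`.  Edges: `k = 0` (both sides `#posRange · [1 ≤ D]`… both
equal `Σ_{n} [0 ≤ D]`-type constants — check: empty product `= 1`), `D = 0` (both `0`). Leans on:
`smoothPart`, `smoothPart_ne_zero`, `factorization_smoothPart`, `smoothPart_dvd`,
`smoothPart_mem_smoothNumbers`, `Nat.mem_divisors`, `Fintype.mem_piFinset`, `Nat.mem_primeFactors`. -/
theorem stub_typeISumSwap :
    ∀ (k : ℕ) (f : Fin k → ℤ[X]) (B : Fin k → ℕ) (D x : ℕ),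
      (∑ n ∈ (Icc 1 x).filter (fun n : ℕ => ∀ i, 0 < (f i).eval (n : ℤ)),
          ∑ d ∈ (Fintype.piFinset fun i =>
              (smoothPart (B i) ((f i).eval (n : ℤ)).toNat).divisors) with (∏ i, d i) ≤ D,
            ∏ i, (ArithmeticFunction.moebius (d i) : ℤ)) =
        ∑ d ∈ (Fintype.piFinset fun _ : Fin k => Icc 1 D) with
            ((∏ i, d i) ≤ D ∧ ∀ i, ∀ p ∈ (d i).primeFactors, p < B i),
          (∏ i, (ArithmeticFunction.moebius (d i) : ℤ)) *
            ((#((Icc 1 x).filter (fun n : ℕ => (∀ i, 0 < (f i).eval (n : ℤ)) ∧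
                ∀ i, ((d i : ℕ) : ℤ) ∣ (f i).eval (n : ℤ))) : ℕ) : ℤ) := by
  sorry

/-- **S2c — CongruenceCount (v2; periodic counting of the joint congruence classes; size S/M,
provable now; tree vocabulary only).**  For moduli `dᵢ ≥ 1` and any polynomials `fᵢ`:
`|#{1 ≤ n ≤ x : ∀ i, dᵢ ∣ fᵢ(n)} − x·ρ_f(d⃗)/∏dᵢ| ≤ ρ_f(d⃗)`, where
`ρ_f(d⃗) = #{r < ∏dᵢ : ∀ i, dᵢ ∣ fᵢ(r)}` (`rhoTuple`).
Proof plan: the predicate `P(n) :≡ ∀ i, dᵢ ∣ fᵢ(n)` is `L`-periodic, `L = ∏ dᵢ ≥ 1`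
(`Polynomial.eval` respects congruences: `Int.ModEq`/`Polynomial.eval_intCast_map`-free route:
`(a : ℤ) ≡ b [ZMOD dᵢ] → fᵢ(a) ≡ fᵢ(b) [ZMOD dᵢ]` is `Int.ModEq.polynomial_eval` … in Mathlib as
`Polynomial.Int.ModEq`? — if absent, induct on the polynomial (`Polynomial.induction_on'`) using
`Int.ModEq.add/mul/pow`), and `dᵢ ∣ L`; so `#{n ∈ Icc 1 x : P n} = Σ_{r < L, P r} #{n ∈ Icc 1 x :
n ≡ r (mod L)}` (`Finset.card_eq_sum_card_fiberwise` with `n ↦ n % L`), and each class count is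
within `1` of `x/L` (`Nat.count_modEq_card`/`Nat.Ico_filter_modEq_card`, or directly
`⌊x/L⌋ ≤ # ≤ ⌊x/L⌋ + 1`); sum the `ρ` errors.  A generic periodic-counting lemma (any decidable
`L`-periodic `P`) is the natural helper; the tree's `IntervalResidueClassSieve` /
`card_filter_range_mul_modEq_le` (PolynomialCongruencesRootCount) may shortcut it. Edge `k = 0`:
`L = 1`, `ρ = 1`, count `= x`: `|x − x| ≤ 1`. -/
theorem stub_congruenceCount :
    ∀ (k : ℕ) (f : Fin k → ℤ[X]) (d : Fin k → ℕ) (x : ℕ), (∀ i, 0 < d i) →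
      |((#((Icc 1 x).filter (fun n : ℕ => ∀ i, ((d i : ℕ) : ℤ) ∣ (f i).eval (n : ℤ))) : ℕ) : ℝ) -
          (x : ℝ) * ((#((range (∏ i, d i)).filter
              (fun r : ℕ => ∀ i, ((d i : ℕ) : ℤ) ∣ (f i).eval (r : ℤ))) : ℕ) : ℝ) /
            ((∏ i, d i : ℕ) : ℝ)| ≤
        ((#((range (∏ i, d i)).filter
            (fun r : ℕ => ∀ i, ((d i : ℕ) : ℤ) ∣ (f i).eval (r : ℤ))) : ℕ) : ℝ) := by
  sorry

/-- **S2b — TruncatedSingularSeries (v4; THE PRIME-IDEAL-THEOREM CONTENT of the Type-I side;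
size L for `k = 1`, XL for `k ≥ 2`; held by the lead; tree vocabulary only).**  For a Bateman–Horn
system `f` of `k ≥ 1` polynomials, the hyperbolically truncated singular series vanishes to order
`(log D)^{-k}`: `S_f(D)·(log D)^k → 0`, `S_f(D) = Σ_{1 ≤ dᵢ ≤ D, ∏dᵢ ≤ D} (∏ᵢ μ(dᵢ))·ρ_f(d⃗)/∏dᵢ`,
`ρ_f(d⃗) = #{r < ∏dᵢ : ∀ i, dᵢ ∣ fᵢ(r)}` (`truncSingularSum`, `rhoTuple`).  (`k = 0`: `S ≡ 1`,
excluded — the composition treats the empty system directly.)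
Why true / proof route: the Dirichlet series `Σ_{d⃗} μ(d⃗)ρ_f(d⃗)(∏dᵢ)^{-s}` is
`H(s)/∏ᵢ ζ_{Kᵢ}(s)`, `Kᵢ = ℚ[X]/(fᵢ)`, with `H` an Euler product absolutely convergent on
`Re s > 1/2` (at a prime `p` outside the finitely many resultant/index primes the joint count at a
tuple with two coordinates divisible by `p` vanishes, the rest factorises, and `#{𝔭 : N𝔭 = p} =
ρ_{fᵢ}(p)` by Dedekind–Kummer — this is where `irreducible` and `pairwise_not_associated` are
load-bearing, cf. Disproof `roughValueLaw_false_without_nonAssociated/_irreducible`), so it has a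
zero of order exactly `k` at `s = 1` and the partial sums of its coefficients weighted `1/n` are
`≪ exp(−c√log D)` by the classical zero-free region.  `k = 1`: Landau's prime ideal theorem in
M-function form, `Σ_{m ≤ y} μ(m)ρ_f(m)/m ≪ exp(−c√log y)`; `k ≥ 2`: hyperbola induction on `k`
using the coprime-to-`𝔠` variants.  Tree inputs (all PROVED):
`Literature.NumberTheory.LFunctions.NumberField.logRieszMean_LSeries_div_dedekindZeta_bound`,
`….idealMoebius_logRieszMean_bound`, `….coprimeMoebius_logRieszMean_bound` (Landau's Möbius prime
ideal theorem with de la Vallée-Poussin error, log-Riesz form),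
`….DegreeOnePrimes.exists_card_absNorm_eq_prime_eq_rootCount` (Dedekind–Kummer),
`….DegreeOnePrimes.abs_sum_primesLE_rootCount_mul_log_sub_self_le` (PNT for `ρ_g`),
`LogEulerProduct.*`, `idealNormCount_mul_of_coprime`, `polyRootCountMod_mul_of_coprime`,
`irreducible_integralNormalization` / `polyRootCountMod_integralNormalization` (non-monic
reduction).  Missing: only elementary-analytic glue (Euler-product comparison; de-smoothing of the
first-order Riesz mean `S(x) = (R(xe^h) − R(x))/h + O(h·log^{deg} x)`, `h = √E`; `ρ_f` tail bounds)
— an L-sized development for `k = 1`, not a missing named fact. -/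
theorem stub_truncatedSingularSeries :
    ∀ (k : ℕ) (f : Fin k → ℤ[X]), IsBatemanHornSystem f → 0 < k →
      Tendsto (fun D : ℕ =>
        (∑ d ∈ (Fintype.piFinset fun _ : Fin k => Icc 1 D) with (∏ i, d i) ≤ D,
            (∏ i, (ArithmeticFunction.moebius (d i) : ℝ)) *
              ((#((range (∏ i, d i)).filter
                  (fun r : ℕ => ∀ i, ((d i : ℕ) : ℤ) ∣ (f i).eval (r : ℤ))) : ℕ) : ℝ) /
              (∏ i, ((d i : ℕ) : ℝ))) * Real.log D ^ k)
        atTop (𝓝 0) := by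
  sorry

/-- **S3 — DeepTailComplement: THE RESIDUAL (open problem; declared, not claimed).**  For a BH
system `f`, Buchstab `ω`, `u > 2`, `0 < θ < 1`: if the Type-I part tends to `M`, the deep tail
`deepSum(θ)·(log x)^k/x` tends to `(C(f)/∏deg fᵢ)·(uω(u))^k − M`.  By `deepSum_eq_sum_filter` the
deep tail is a signed count, with the `f`-INDEPENDENT kernel `h_D`, over the `n ≤ x` whose friable
parts have `∏ sᵢ(n) > x^θ` (model density Tenenbaum's `ϑ(u, θu/d)`: for `n²+1`, `θ → 1`: 0.225,
0.096, 0.012, 1.1·10⁻³ at `u = 3, 4, 6, 8`), with explicit target for `k = 1`: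
`T_f(u,θ) = (C/d)·u·(ω(u) − ω(θu/d)·1[θu/d>1])` (TRIAGE-r1-1/3: −24 %, +6 %, −1 % of the rung of
`n²+1` at `u = 3, 4, 6`, `θ = 0.95`).  STATUS: modulo S1 + S2 this statement is EQUIVALENT to the crux with the
pinned constant `A = C(f)/∏deg fᵢ` (`systemRoughValueLaw_of_parts` and
`deepTailComplement_of_pinnedLaw` below, both kernel-checked) — it is the crux's entire non-Type-I
content, parity-complete (`Literature.Barriers.Parity.SelbergParityBarrier` bites: the twist
`1 ± λ(F(n))` moves it by an `O(1)`-relative amount on the same support; `LinearSieveOptimality`: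
`|T|/M ≍` the linear-sieve window `ρ(u/d−1)/(u/d)`), of Bateman–Horn strength on every rung
`u ∈ (2,3)` (`eventually_cardFactors_le_two`).  What the line does to it: S4 moves the level to
`x^{1+δ₀}` for quadratics (`DeepTailBeyond`, `u ≥ u₀`); nothing for `d_tot ≥ 3`
(`FordMaynardLowLevel`: the self-dual range `(x^{1+δ}, x^{d_tot−1−δ})` of moduli survives any
switching).  Degree-1 single polynomials (`aX+b`): provable now (Buchstab–de Bruijn in a progression;
the rungs `X`, `2X+1` are machine-checked in Disproof.lean as `tendsto_ratio_X`,
`conclusion_twoXAddOne`).  Expected `A`: `bhA f` (those two rungs; FL calibration = the route's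
support item SieveCalibration). -/
theorem stub_deepTailComplement :
    ∀ (k : ℕ) (f : Fin k → ℤ[X]), IsBatemanHornSystem f → ∀ ω : ℝ → ℝ, IsBuchstab ω →
      ∀ u θ : ℝ, 2 < u → 0 < θ → θ < 1 → ∀ M : ℝ, Tendsto (typeINorm f u θ) atTop (𝓝 M) →
        Tendsto (deepNorm f u θ) atTop (𝓝 (bhA f * (u * ω u) ^ k - M)) := by
  sorry

/-- **S4 — TypeILevelPush: THE LEVER (size XL; HARDEST CLAIMED stub; provable now for `n² + 1`).**
For ONE Bateman–Horn quadratic `f` (`IsBatemanHornSystem ![f]`, `deg f = 2`) and Buchstab `ω`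
there is `u₀ > 2` such that for every `u ≥ u₀` and all `0 < δ ≤ δ₀(u)`:
`typeISum(1+δ)·log x/x → (C(f)/2)·u·ω((1+δ)u/2)` — the n-wise Type-I law BEYOND `x`.
Proof plan: swap sums (as in S2): `typeISum(1+δ) = x·G_f(x^{1+δ}, z) + R`, `z = ⌈x^{2/u}⌉`,
`R = Σ_{d ≤ x^{1+δ}, P⁺(d) < z} μ(d)·r_d(x)`, `r_d(x) = #{1 ≤ n ≤ x : d ∣ f(n)} − xρ_f(d)/d`.
MAIN TERM: `(log x)·G_f(z^s, z) → C(f)·ω(s)·u/2` with `s = (1+δ)u/2 > 1` (S2's analysis is a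
statement about the arithmetic function `μρ_f` alone — the level may exceed `x`).  REMAINDER:
`d ≤ x^{1−η}` trivially (`|r_d| ≤ ρ_f(d)`); for `x^{1−η} < d ≤ x^{1+δ}` the modulus is `z`-FRIABLE,
hence factors as `d = mn`, `(m,n) = 1`, with `n ∈ [N₀/z, N₀)` for ANY prescribed `N₀` (multiply the
prime factors in increasing order; the cross-condition `P⁺(n) < P⁻(m)` is separated at a `log` cost),
so `R` is a sum of `O(log² x)` bilinear forms `Σ_m α_m Σ_n β_n r_{mn}` with `|α|,|β| ≤ 1`, `β`
supported on squarefrees: (a) `n² + 1`: the tree's PROVED `Iwaniec1978.proposition1_corollary_holds`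
(`Σ_{m < x^{1−4ε}} |Σ_{n < x^{1/15−ε},(n,m)=1} b_n r(𝒜; mn)| ≪_ε x^{1−ε}`, level `x^{16/15}`) covers
every friable `d ∈ (x^{1−η}, x^{1+δ}]` once `2/u + δ + 5ε < 1/15`, i.e. `u₀ = 31`,
`δ₀(u) = 1/15 − 2/u − 5ε`; (b) `n² + 1`, better constants: Merikoski 2022 Prop. 4 — (i) general
`b_n`, `x^{α−1+η} ≪ N ≪ x^{(57−32α)/96−η}`, (ii) `b_n` on primes, `x^{2(α−1)+η} ≪ N ≪
x^{(128−103α)/75−η}` (`α = log d/log x ∈ (1−η, 1+δ]`): take `n = P⁺(d)` in (ii) when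
`P⁺(d) ≥ x^{2δ+η}` (needs `z ≤ x^{1/3−O(δ)}`, i.e. `u ≥ 6`), else `d` is `x^{2δ+η}`-friable and (i)
applies by greedy factorisation — `u₀ = 6` (TRIAGE-r1-1 (2)); (c) general BH quadratics: Iwaniec's
dispersion "similar for `aX²+bX+c`" (p. 172) = the tree's predicate `Iwaniec1978.proposition1G a b c`
with `proposition1G_corollary_of_prop1G` (PROVED reduction), Lemke Oliver 2012 Lemma 3, or
de la Bretèche–Drappeau (arXiv:1703.03197) / DFI 1995 + Tóth 2000 bilinear forms in root Weyl sums.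
The smoothing `#{n ≤ x : n ≡ ν (d)} − x/d = ψ(−ν/d) − ψ((x−ν)/d)` and the positivity clause of
`posRange` (cofinite) are bookkeeping.  NOT claimed for `deg f = 1` (there moduli beyond the size of
the values give empty classes: the n-wise Type-I sum at level `≥ x^{1+δ}` IS `Φ_f`, limit `u·ω(u)`,
not `u·ω((1+δ)u)`), nor for `deg ≥ 3` (no root equidistribution beyond `x^{1−ε}`), nor uniformly in
`u` (`not_roughValueLawUniform`).  Consistency: at `θ = 2` the n-wise Type-I sum is `Φ_f` itself and
`(C/2)·u·ω(2u/2)` is the crux's prediction — the level law interpolates from theorem (`θ ≤ 1+δ₀`) to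
conjecture (`θ = 2`).  Leans on: `Iwaniec1978.proposition1_corollary_holds`, `Iwaniec1978.bilinearB`,
`Iwaniec1978.rem`, `Iwaniec1978.proposition1G`, `proposition1G_corollary_of_prop1G`,
`abs_remG_le_rhoG`, `isBatemanHornSystem_X_sq_add_one`, `Iwaniec1978.tendsto_densityProd_mul_log`
(PROVED Mertens for `ρ_{n²+1}`), S2's PIT inputs; sources [IwaniecInventiones1978, Cor. p. 176],
[Merikoski2022, Prop. 4], [BretecheDrappeau2017], [DukeFriedlanderIwaniec1995], [Toth2000],
[LemkeOliverActaArith2012, Lemma 3], [Polymath8a2014] (densely divisible moduli).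
Why it might fail: only through the main term (if `λ(s) ≠ e^γω(s)` — refuted by three triagers'
derivations and numerics) or a mis-set range (`u₀`, `δ₀` are existential here on purpose). -/
theorem stub_typeILevelPush :
    ∀ f : ℤ[X], IsBatemanHornSystem ![f] → f.natDegree = 2 → ∀ ω : ℝ → ℝ, IsBuchstab ω →
      ∃ u₀ : ℝ, 2 < u₀ ∧ ∀ u : ℝ, u₀ ≤ u → ∃ δ₀ : ℝ, 0 < δ₀ ∧ ∀ δ : ℝ, 0 < δ → δ ≤ δ₀ →
        Tendsto (typeINorm ![f] u (1 + δ)) atTop (𝓝 (bhA ![f] * (u * ω ((1 + δ) * u / 2)))) := by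
  sorry

/-! ## §3 Localisation of the deep tail (sorry-free) -/

/-- The deep kernel vanishes unless the friable parts have product `> D` (`dᵢ ∣ sᵢ`, `sᵢ > 0` force
`∏ dᵢ ≤ ∏ sᵢ`).  This is the card's "the parity of the rung lives on the abnormally friable values". -/
theorem deepKernel_eq_zero_of_prod_le {k : ℕ} {D : ℕ} {s : Fin k → ℕ}
    (hs : ∀ i, 0 < s i) (hD : ∏ i, s i ≤ D) : deepKernel D s = 0 := by
  unfold deepKernel
  refine Finset.sum_eq_zero fun d hd => ?_
  rw [Finset.mem_filter, Fintype.mem_piFinset] at hd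
  exfalso
  have hle : ∏ i, d i ≤ ∏ i, s i :=
    Finset.prod_le_prod' fun i _ => Nat.le_of_dvd (hs i) (Nat.mem_divisors.mp (hd.1 i)).1
  exact absurd (hd.2.trans_le (hle.trans hD)) (lt_irrefl _)

/-- Friable parts are positive (`smoothPart_ne_zero`). -/
theorem friableParts_pos {k : ℕ} (f : Fin k → ℤ[X]) (B : Fin k → ℕ) (n : ℕ) (i : Fin k) :
    0 < friableParts f B n i :=
  Nat.pos_of_ne_zero (smoothPart_ne_zero _ _)

/-- **Localisation**: the deep tail is a sum over Tenenbaum's "large friable component" set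
`{n : ∏ᵢ sᵢ(n) > ⌊x^θ⌋}` only. -/
theorem deepSum_eq_sum_filter {k : ℕ} (f : Fin k → ℤ[X]) (u θ : ℝ) (x : ℕ) :
    deepSum f u θ x =
      ∑ n ∈ (posRange f x).filter
          (fun n : ℕ => level θ x < ∏ i, friableParts f (sieveBound f u x) n i),
        deepKernel (level θ x) (friableParts f (sieveBound f u x) n) := by
  rw [deepSum, Finset.sum_filter_of_ne]
  intro n _ hne
  by_contra hle
  exact hne (deepKernel_eq_zero_of_prod_le (friableParts_pos f _ n) (not_lt.mp hle))

/-! ## §4 Composition (sorry-free): S1 + S2 + S3 ⟹ the crux BY NAME -/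

/-- S1 at `B = sieveBound`, `D = level θ x`: `Φ_f(x,u) = typeISum(θ) + deepSum(θ)` (any `θ`). -/
theorem roughCount_eq_typeISum_add_deepSum (h₁ : FriableDecomposition) {k : ℕ} (f : Fin k → ℤ[X])
    (u θ : ℝ) (x : ℕ) : (roughCount f u x : ℝ) = (typeISum f u θ x : ℝ) + (deepSum f u θ x : ℝ) := by
  have h : ((roughCount f u x : ℕ) : ℤ) = typeISum f u θ x + deepSum f u θ x := by
    rw [typeISum, deepSum, ← Finset.sum_add_distrib]
    exact h₁ k f (sieveBound f u x) (level θ x) x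
  exact_mod_cast h

/-- Normalised form: `Φ_f·(log x)^k/x = typeINorm(θ) + deepNorm(θ)`. -/
theorem roughNorm_eq (h₁ : FriableDecomposition) {k : ℕ} (f : Fin k → ℤ[X]) (u θ : ℝ) (x : ℕ) :
    roughNorm f u x = typeINorm f u θ x + deepNorm f u θ x := by
  rw [roughNorm, typeINorm, deepNorm, roughCount_eq_typeISum_add_deepSum h₁ f u θ x]
  ring

/-- **Transfer C⁺ ⟹ crux, system by system** (the card's `TransferClosesCrux`, now a proof): from the
identity, the Type-I limit at level `x^{1/2}` and the deep-tail complement, the crux's conclusion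
holds for the system with `A = C(f)/∏ deg fᵢ`. -/
theorem systemRoughValueLaw_of_parts (h₁ : FriableDecomposition) (h₂ : TypeILimitBelow)
    (h₃ : DeepTailComplement) :
    ∀ (k : ℕ) (f : Fin k → ℤ[X]), IsBatemanHornSystem f → SystemRoughValueLaw k f := by
  intro k f hf ω hω
  refine ⟨bhA f, fun u hu => ?_⟩
  obtain ⟨M, hM⟩ := h₂ k f hf u hu
  have hT := h₃ k f hf ω hω u (thetaKU k u) hu (thetaKU_pos k (by linarith))
    (thetaKU_lt_one k hu) M hM
  have hsum := hM.add hT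
  have hval : M + (bhA f * (u * ω u) ^ k - M) = bhA f * (u * ω u) ^ k := by ring
  rw [hval] at hsum
  refine hsum.congr fun x => ?_
  rw [← roughNorm_eq h₁ f u (thetaKU k u) x]
  rfl

/-! ### Bridges from the registered (unfolded / specialised) stubs to the named statements -/

/-- S1 as registered (tree vocabulary) is DEFINITIONALLY the statement `FriableDecomposition`
(unfold `posRange`, `typeIKernel`, `deepKernel`, `friableParts`). -/
theorem friableDecomposition_iff :
    FriableDecomposition ↔
      ∀ (k : ℕ) (f : Fin k → ℤ[X]) (B : Fin k → ℕ) (D x : ℕ),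
        ((#((Icc 1 x).filter (fun n : ℕ => ∀ i, 0 < (f i).eval (n : ℤ) ∧
            ∀ p ∈ range (B i), p.Prime → ¬ ((p : ℤ) ∣ (f i).eval (n : ℤ)))) : ℕ) : ℤ) =
          ∑ n ∈ (Icc 1 x).filter (fun n : ℕ => ∀ i, 0 < (f i).eval (n : ℤ)),
            ((∑ d ∈ (Fintype.piFinset fun i =>
                  (smoothPart (B i) ((f i).eval (n : ℤ)).toNat).divisors) with (∏ i, d i) ≤ D,
                ∏ i, (ArithmeticFunction.moebius (d i) : ℤ)) +
             (∑ d ∈ (Fintype.piFinset fun i =>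
                  (smoothPart (B i) ((f i).eval (n : ℤ)).toNat).divisors) with D < ∏ i, d i,
                ∏ i, (ArithmeticFunction.moebius (d i) : ℤ))) :=
  Iff.rfl

/-- S1 (registered form) gives `FriableDecomposition`. -/
theorem friableDecomposition_of_stub : FriableDecomposition :=
  friableDecomposition_iff.mpr stub_friableDecomposition

/-- S2a as registered is DEFINITIONALLY the swap identity over this file's vocabulary:
`typeISum`-summand form `= Σ_{d⃗ ∈ tupleSet B D} (∏ μ(dᵢ)) · congCountPos f d⃗ x`. -/
theorem typeISumSwap_iff :
    (∀ (k : ℕ) (f : Fin k → ℤ[X]) (B : Fin k → ℕ) (D x : ℕ),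
        ∑ n ∈ posRange f x, typeIKernel D (friableParts f B n) =
          ∑ d ∈ tupleSet B D, (∏ i, (ArithmeticFunction.moebius (d i) : ℤ)) *
            ((congCountPos f d x : ℕ) : ℤ)) ↔
      ∀ (k : ℕ) (f : Fin k → ℤ[X]) (B : Fin k → ℕ) (D x : ℕ),
        (∑ n ∈ (Icc 1 x).filter (fun n : ℕ => ∀ i, 0 < (f i).eval (n : ℤ)),
            ∑ d ∈ (Fintype.piFinset fun i =>
                (smoothPart (B i) ((f i).eval (n : ℤ)).toNat).divisors) with (∏ i, d i) ≤ D,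
              ∏ i, (ArithmeticFunction.moebius (d i) : ℤ)) =
          ∑ d ∈ (Fintype.piFinset fun _ : Fin k => Icc 1 D) with
              ((∏ i, d i) ≤ D ∧ ∀ i, ∀ p ∈ (d i).primeFactors, p < B i),
            (∏ i, (ArithmeticFunction.moebius (d i) : ℤ)) *
              ((#((Icc 1 x).filter (fun n : ℕ => (∀ i, 0 < (f i).eval (n : ℤ)) ∧
                  ∀ i, ((d i : ℕ) : ℤ) ∣ (f i).eval (n : ℤ))) : ℕ) : ℤ) :=
  Iff.rfl

/-- The swapped form of the Type-I sum (from S2a): `typeISum f u θ x =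
Σ_{d⃗ ∈ tupleSet (sieveBound f u x) (level θ x)} (∏ μ(dᵢ)) · congCountPos f d⃗ x`. -/
theorem typeISum_eq_sum_tupleSet {k : ℕ} (f : Fin k → ℤ[X]) (u θ : ℝ) (x : ℕ) :
    typeISum f u θ x =
      ∑ d ∈ tupleSet (sieveBound f u x) (level θ x),
        (∏ i, (ArithmeticFunction.moebius (d i) : ℤ)) * ((congCountPos f d x : ℕ) : ℤ) :=
  (typeISumSwap_iff.mpr stub_typeISumSwap) k f (sieveBound f u x) (level θ x) x

/-- S2c as registered is DEFINITIONALLY `|congCount − x·rhoTuple/∏dᵢ| ≤ rhoTuple`. -/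
theorem congruenceCount_iff :
    (∀ (k : ℕ) (f : Fin k → ℤ[X]) (d : Fin k → ℕ) (x : ℕ), (∀ i, 0 < d i) →
        |((congCount f d x : ℕ) : ℝ) - (x : ℝ) * ((rhoTuple f d : ℕ) : ℝ) / ((∏ i, d i : ℕ) : ℝ)| ≤
          ((rhoTuple f d : ℕ) : ℝ)) ↔
      ∀ (k : ℕ) (f : Fin k → ℤ[X]) (d : Fin k → ℕ) (x : ℕ), (∀ i, 0 < d i) →
        |((#((Icc 1 x).filter (fun n : ℕ => ∀ i, ((d i : ℕ) : ℤ) ∣ (f i).eval (n : ℤ))) : ℕ) : ℝ) -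
            (x : ℝ) * ((#((range (∏ i, d i)).filter
                (fun r : ℕ => ∀ i, ((d i : ℕ) : ℤ) ∣ (f i).eval (r : ℤ))) : ℕ) : ℝ) /
              ((∏ i, d i : ℕ) : ℝ)| ≤
          ((#((range (∏ i, d i)).filter
              (fun r : ℕ => ∀ i, ((d i : ℕ) : ℤ) ∣ (f i).eval (r : ℤ))) : ℕ) : ℝ) :=
  Iff.rfl

/-- The congruence-class count (from S2c), named form. -/
theorem abs_congCount_sub_le {k : ℕ} (f : Fin k → ℤ[X]) (d : Fin k → ℕ) (x : ℕ)
    (hd : ∀ i, 0 < d i) :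
    |((congCount f d x : ℕ) : ℝ) - (x : ℝ) * ((rhoTuple f d : ℕ) : ℝ) / ((∏ i, d i : ℕ) : ℝ)| ≤
      ((rhoTuple f d : ℕ) : ℝ) :=
  (congruenceCount_iff.mpr stub_congruenceCount) k f d x hd

/-! ### §4b (v4) Reduction of S2 to S2a + S2b + S2c — every remainder is trivial at `θ_{k,u}`

With `θ = θ_{k,u}`, `D = ⌊x^θ⌋`, `Bᵢ = ⌈x^{deg fᵢ/u}⌉`, `T = tupleSet B D`:
`typeISum = Σ_{d⃗ ∈ T} μ(d⃗)·N⁺(d⃗)` (S2a); `|N⁺(d⃗) − N(d⃗)| ≤ n₀(f)`; `|N(d⃗) − x·ρ(d⃗)/∏dᵢ| ≤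
ρ(d⃗) ≤ ∏dᵢ ≤ D` (S2c and the trivial bound); `|μ(d⃗)| ≤ 1`; `|T| ≤ D^k`.  Hence
`|typeISum − x·densitySum| ≤ D^k·(n₀ + D) ≤ (n₀+1)·x^{(k+1)θ} ≤ (n₀+1)x^{1/2}`; and for `x ≥ 2`,
`D < x^{1/u} ≤ Bᵢ` makes the friability condition vacuous: `densitySum = S_f(D)`, which is
`o((log D)^{-k}) = o((log x)^{-k})` by S2b (`k ≥ 1`; `≡ 1` for `k = 0`). -/

/-- `|∏ μ(dᵢ)| ≤ 1`. -/
theorem abs_prod_moebius_le_one {k : ℕ} (d : Fin k → ℕ) :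
    |(∏ i, (ArithmeticFunction.moebius (d i) : ℝ))| ≤ 1 := by
  rw [Finset.abs_prod]
  refine Finset.prod_le_one (fun i _ => abs_nonneg _) fun i _ => ?_
  have h := (ArithmeticFunction.abs_moebius_le_one (n := d i))
  have : |((ArithmeticFunction.moebius (d i) : ℤ) : ℝ)| ≤ 1 := by exact_mod_cast h
  simpa using this

/-- `ρ_f(d⃗) ≤ ∏ dᵢ` (it counts residues below the modulus). -/
theorem rhoTuple_le_prod {k : ℕ} (f : Fin k → ℤ[X]) (d : Fin k → ℕ) :
    rhoTuple f d ≤ ∏ i, d i := by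
  unfold rhoTuple
  exact (card_filter_le _ _).trans (card_range _).le

/-- `|tupleSet B D| ≤ D^k`. -/
theorem card_tupleSet_le {k : ℕ} (B : Fin k → ℕ) (D : ℕ) : #(tupleSet B D) ≤ D ^ k := by
  unfold tupleSet
  refine (card_filter_le _ _).trans ?_
  rw [Fintype.card_piFinset, Finset.prod_const, Nat.card_Icc, Finset.card_univ, Fintype.card_fin]
  simp

/-- Members of `tupleSet B D` have `1 ≤ dᵢ` and `∏ dᵢ ≤ D`. -/
theorem mem_tupleSet {k : ℕ} {B : Fin k → ℕ} {D : ℕ} {d : Fin k → ℕ} (hd : d ∈ tupleSet B D) :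
    (∀ i, 1 ≤ d i) ∧ (∏ i, d i) ≤ D := by
  unfold tupleSet at hd
  rw [mem_filter, Fintype.mem_piFinset] at hd
  exact ⟨fun i => (mem_Icc.mp (hd.1 i)).1, hd.2.1⟩

/-- **Vacuous friability**: if `D < Bᵢ` for every `i`, then `tupleSet B D = tupleSet₀ k D` (every
prime factor of `dᵢ ≤ ∏ dⱼ ≤ D` is `< Bᵢ`). -/
theorem tupleSet_eq_tupleSet₀ {k : ℕ} {B : Fin k → ℕ} {D : ℕ} (h : ∀ i, D < B i) :
    tupleSet B D = tupleSet₀ k D := by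
  unfold tupleSet tupleSet₀
  refine Finset.filter_congr fun d hd => ⟨fun hh => hh.1, fun hh => ⟨hh, fun i p hp => ?_⟩⟩
  rw [Fintype.mem_piFinset] at hd
  have hdi : d i ≤ D := (mem_Icc.mp (hd i)).2
  exact lt_of_le_of_lt ((Nat.le_of_mem_primeFactors hp).trans hdi) (h i)

/-- Hence `densitySum f B D = truncSingularSum f D` when `D < Bᵢ` for all `i`. -/
theorem densitySum_eq_truncSingularSum {k : ℕ} (f : Fin k → ℤ[X]) {B : Fin k → ℕ} {D : ℕ}
    (h : ∀ i, D < B i) : densitySum f B D = truncSingularSum f D := by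
  rw [densitySum, truncSingularSum, tupleSet_eq_tupleSet₀ h]

/-- The positivity clause costs at most `n₀`: `N(d⃗) ≤ N⁺(d⃗) + n₀` when every `fᵢ(n) > 0` for
`n ≥ n₀`. -/
theorem congCount_le_congCountPos_add {k : ℕ} (f : Fin k → ℤ[X]) (d : Fin k → ℕ) (x : ℕ)
    {n₀ : ℕ} (hn₀ : ∀ i, ∀ n : ℕ, n₀ ≤ n → 0 < (f i).eval (n : ℤ)) :
    congCount f d x ≤ congCountPos f d x + n₀ := by
  unfold congCount congCountPos
  calc #((Icc 1 x).filter (fun n : ℕ => ∀ i, ((d i : ℕ) : ℤ) ∣ (f i).eval (n : ℤ)))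
      ≤ #((Icc 1 x).filter (fun n : ℕ => (∀ i, 0 < (f i).eval (n : ℤ)) ∧
            ∀ i, ((d i : ℕ) : ℤ) ∣ (f i).eval (n : ℤ)) ∪ range n₀) := by
        refine card_le_card fun n hn => ?_
        rw [mem_filter] at hn
        rw [mem_union, mem_filter, mem_range]
        by_cases h : n₀ ≤ n
        · exact Or.inl ⟨hn.1, fun i => hn₀ i n h, hn.2⟩
        · exact Or.inr (not_le.mp h)
    _ ≤ _ := (card_union_le _ _).trans (by rw [card_range])

/-- … and trivially `N⁺(d⃗) ≤ N(d⃗)`. -/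
theorem congCountPos_le_congCount {k : ℕ} (f : Fin k → ℤ[X]) (d : Fin k → ℕ) (x : ℕ) :
    congCountPos f d x ≤ congCount f d x := by
  unfold congCount congCountPos
  exact card_le_card (fun n hn => by
    rw [mem_filter] at hn ⊢
    exact ⟨hn.1, hn.2.2⟩)

/-- The fixed-`x` remainder bound of the swapped Type-I sum (any level exponent `θ`):
`|typeISum − x·densitySum| ≤ D^k·(n₀ + D)`, `D = level θ x`. -/
theorem abs_typeISum_sub_densitySum_le {k : ℕ} (f : Fin k → ℤ[X]) (u θ : ℝ) (x : ℕ) {n₀ : ℕ}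
    (hn₀ : ∀ i, ∀ n : ℕ, n₀ ≤ n → 0 < (f i).eval (n : ℤ)) :
    |(typeISum f u θ x : ℝ) - (x : ℝ) * densitySum f (sieveBound f u x) (level θ x)| ≤
      ((level θ x : ℕ) : ℝ) ^ k * ((n₀ : ℝ) + (level θ x : ℕ)) := by
  set D : ℕ := level θ x with hD
  set T := tupleSet (sieveBound f u x) D with hT
  have hswap : (typeISum f u θ x : ℝ) =
      ∑ d ∈ T, (∏ i, (ArithmeticFunction.moebius (d i) : ℝ)) * ((congCountPos f d x : ℕ) : ℝ) := by
    have h := typeISum_eq_sum_tupleSet f u θ x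
    rw [← hD, ← hT] at h
    have h' : ((typeISum f u θ x : ℤ) : ℝ) =
        ((∑ d ∈ T, (∏ i, (ArithmeticFunction.moebius (d i) : ℤ)) * ((congCountPos f d x : ℕ) : ℤ) :
          ℤ) : ℝ) := by rw [h]
    rw [h']
    push_cast
    rfl
  have hmain : (x : ℝ) * densitySum f (sieveBound f u x) D =
      ∑ d ∈ T, (∏ i, (ArithmeticFunction.moebius (d i) : ℝ)) *
        ((x : ℝ) * ((rhoTuple f d : ℕ) : ℝ) / ((∏ i, d i : ℕ) : ℝ)) := by
    rw [densitySum, ← hT, Finset.mul_sum]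
    refine Finset.sum_congr rfl fun d _ => ?_
    rw [densityTerm]
    push_cast
    ring
  rw [hswap, hmain, ← Finset.sum_sub_distrib]
  have hpt : ∀ d ∈ T,
      |(∏ i, (ArithmeticFunction.moebius (d i) : ℝ)) * ((congCountPos f d x : ℕ) : ℝ) -
          (∏ i, (ArithmeticFunction.moebius (d i) : ℝ)) *
            ((x : ℝ) * ((rhoTuple f d : ℕ) : ℝ) / ((∏ i, d i : ℕ) : ℝ))| ≤ (n₀ : ℝ) + D := by
    intro d hd
    obtain ⟨hd1, hdD⟩ := mem_tupleSet hd
    have hdpos : ∀ i, 0 < d i := fun i => hd1 i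
    rw [← mul_sub, abs_mul]
    have hμ := abs_prod_moebius_le_one (k := k) d
    have hN : |((congCountPos f d x : ℕ) : ℝ) -
        (x : ℝ) * ((rhoTuple f d : ℕ) : ℝ) / ((∏ i, d i : ℕ) : ℝ)| ≤ (n₀ : ℝ) + D := by
      have h1 : |((congCountPos f d x : ℕ) : ℝ) - ((congCount f d x : ℕ) : ℝ)| ≤ n₀ := by
        have ha := congCount_le_congCountPos_add f d x hn₀
        have hb := congCountPos_le_congCount f d x
        rw [abs_sub_le_iff]
        constructor
        · have : ((congCountPos f d x : ℕ) : ℝ) ≤ ((congCount f d x : ℕ) : ℝ) := by exact_mod_cast hb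
          linarith [(Nat.cast_nonneg n₀ : (0 : ℝ) ≤ n₀)]
        · have : ((congCount f d x : ℕ) : ℝ) ≤ ((congCountPos f d x : ℕ) : ℝ) + n₀ := by
            exact_mod_cast ha
          linarith
      have h2 : |((congCount f d x : ℕ) : ℝ) -
          (x : ℝ) * ((rhoTuple f d : ℕ) : ℝ) / ((∏ i, d i : ℕ) : ℝ)| ≤ D := by
        refine (abs_congCount_sub_le f d x hdpos).trans ?_
        have := (rhoTuple_le_prod f d).trans hdD
        exact_mod_cast this
      calc |((congCountPos f d x : ℕ) : ℝ) - (x : ℝ) * ((rhoTuple f d : ℕ) : ℝ) / ((∏ i, d i : ℕ) : ℝ)|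
          = |(((congCountPos f d x : ℕ) : ℝ) - ((congCount f d x : ℕ) : ℝ)) +
              (((congCount f d x : ℕ) : ℝ) -
                (x : ℝ) * ((rhoTuple f d : ℕ) : ℝ) / ((∏ i, d i : ℕ) : ℝ))| := by ring_nf
        _ ≤ _ := abs_add_le _ _
        _ ≤ (n₀ : ℝ) + D := add_le_add h1 h2
    calc |∏ i, (ArithmeticFunction.moebius (d i) : ℝ)| *
          |((congCountPos f d x : ℕ) : ℝ) - (x : ℝ) * ((rhoTuple f d : ℕ) : ℝ) / ((∏ i, d i : ℕ) : ℝ)|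
        ≤ 1 * ((n₀ : ℝ) + D) :=
          mul_le_mul hμ hN (abs_nonneg _) zero_le_one
      _ = (n₀ : ℝ) + D := one_mul _
  refine (Finset.abs_sum_le_sum_abs _ _).trans ?_
  refine (Finset.sum_le_sum hpt).trans ?_
  rw [Finset.sum_const, nsmul_eq_mul]
  have hcard : (#T : ℝ) ≤ (D : ℝ) ^ k := by
    have := card_tupleSet_le (sieveBound f u x) D
    exact_mod_cast this
  have hnn : 0 ≤ (n₀ : ℝ) + D := by positivity
  exact mul_le_mul_of_nonneg_right hcard hnn

/-- The normalised remainder tends to zero at `θ = θ_{k,u}`, `u > 2`: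
`D^k (n₀ + D) (log x)^k / x ≤ (n₀+1)(log x)^k/√x → 0`, `D = ⌊x^θ⌋`. -/
theorem tendsto_remainder_zero (k n₀ : ℕ) {u : ℝ} (hu : 2 < u) :
    Tendsto (fun x : ℕ => ((level (thetaKU k u) x : ℕ) : ℝ) ^ k *
      ((n₀ : ℝ) + (level (thetaKU k u) x : ℕ)) * Real.log x ^ k / (x : ℝ)) atTop (𝓝 0) := by
  set θ : ℝ := thetaKU k u with hθdef
  have hθ : 0 < θ := thetaKU_pos k (by linarith)
  have hθk : ((k : ℝ) + 1) * θ ≤ 1 / 2 := thetaKU_mul_succ_le k hu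
  have hlim : Tendsto (fun y : ℝ => ((n₀ : ℝ) + 1) * (Real.log y ^ k * y ^ (1 / 2 : ℝ) / y))
      atTop (𝓝 0) := by
    have h := (isLittleO_log_rpow_rpow_atTop (k : ℝ) (by norm_num : (0 : ℝ) < 1 / 2)).tendsto_div_nhds_zero
    have h' : Tendsto (fun y : ℝ => Real.log y ^ k * y ^ (1 / 2 : ℝ) / y) atTop (𝓝 0) := by
      refine h.congr' ?_
      filter_upwards [eventually_gt_atTop (0 : ℝ)] with y hy
      have hs : y = y ^ (1 / 2 : ℝ) * y ^ (1 / 2 : ℝ) := by rw [← Real.rpow_add hy]; norm_num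
      have hs0 : (0 : ℝ) < y ^ (1 / 2 : ℝ) := by positivity
      rw [Real.rpow_natCast]
      conv_rhs => arg 2; rw [hs]
      rw [mul_div_mul_right _ _ hs0.ne']
    simpa using h'.const_mul ((n₀ : ℝ) + 1)
  have hnat := hlim.comp tendsto_natCast_atTop_atTop
  refine squeeze_zero' ?_ ?_ hnat
  · filter_upwards [eventually_ge_atTop 1] with x hx
    have hx0 : (0 : ℝ) < x := by exact_mod_cast hx
    positivity
  · filter_upwards [eventually_ge_atTop 1] with x hx
    have hx0 : (0 : ℝ) < x := by exact_mod_cast hx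
    have hx1 : (1 : ℝ) ≤ x := by exact_mod_cast hx
    set D : ℕ := level θ x with hD
    have hDle : (D : ℝ) ≤ (x : ℝ) ^ θ := by
      rw [hD, level]
      exact Nat.floor_le (by positivity)
    have hxθ1 : (1 : ℝ) ≤ (x : ℝ) ^ θ := Real.one_le_rpow hx1 hθ.le
    have h1 : (D : ℝ) ^ k * ((n₀ : ℝ) + D) ≤ ((n₀ : ℝ) + 1) * ((x : ℝ) ^ θ) ^ (k + 1) := by
      have hDk : (D : ℝ) ^ k ≤ ((x : ℝ) ^ θ) ^ k := pow_le_pow_left₀ (by positivity) hDle k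
      have hnD : (n₀ : ℝ) + D ≤ ((n₀ : ℝ) + 1) * (x : ℝ) ^ θ := by
        have : (n₀ : ℝ) ≤ (n₀ : ℝ) * (x : ℝ) ^ θ := le_mul_of_one_le_right (by positivity) hxθ1
        nlinarith
      calc (D : ℝ) ^ k * ((n₀ : ℝ) + D)
          ≤ ((x : ℝ) ^ θ) ^ k * (((n₀ : ℝ) + 1) * (x : ℝ) ^ θ) :=
            mul_le_mul hDk hnD (by positivity) (by positivity)
        _ = ((n₀ : ℝ) + 1) * ((x : ℝ) ^ θ) ^ (k + 1) := by ring
    -- `(x^θ)^{k+1} = x^{(k+1)θ} ≤ x^{1/2}`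
    have h2 : ((x : ℝ) ^ θ) ^ (k + 1) ≤ (x : ℝ) ^ (1 / 2 : ℝ) := by
      rw [← Real.rpow_natCast, ← Real.rpow_mul hx0.le]
      refine Real.rpow_le_rpow_of_exponent_le hx1 ?_
      push_cast
      linarith
    have hlog : 0 ≤ Real.log x ^ k := pow_nonneg (Real.log_nonneg hx1) k
    have H : (D : ℝ) ^ k * ((n₀ : ℝ) + D) ≤ ((n₀ : ℝ) + 1) * (x : ℝ) ^ (1 / 2 : ℝ) :=
      h1.trans (mul_le_mul_of_nonneg_left h2 (by positivity))
    calc (D : ℝ) ^ k * ((n₀ : ℝ) + D) * Real.log x ^ k / (x : ℝ)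
        ≤ ((n₀ : ℝ) + 1) * (x : ℝ) ^ (1 / 2 : ℝ) * Real.log x ^ k / (x : ℝ) :=
          div_le_div_of_nonneg_right (mul_le_mul_of_nonneg_right H hlog) hx0.le
      _ = ((n₀ : ℝ) + 1) * (Real.log x ^ k * (x : ℝ) ^ (1 / 2 : ℝ) / (x : ℝ)) := by ring
      _ = ((fun y : ℝ => ((n₀ : ℝ) + 1) * (Real.log y ^ k * y ^ (1 / 2 : ℝ) / y)) ∘
            (fun n : ℕ => (n : ℝ))) x := rfl

/-- The level `⌊x^θ⌋` tends to infinity (`θ > 0`). -/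
theorem tendsto_level_atTop {θ : ℝ} (hθ : 0 < θ) : Tendsto (level θ) atTop atTop := by
  unfold level
  exact tendsto_nat_floor_atTop.comp ((tendsto_rpow_atTop hθ).comp tendsto_natCast_atTop_atTop)

/-- Eventually in `x`, the level is below every sifting bound: `⌊x^{θ_{k,u}}⌋ < ⌈x^{deg fᵢ/u}⌉`
(`deg fᵢ ≥ 1`, `θ_{k,u} < 1/u`). -/
theorem eventually_level_lt_sieveBound {k : ℕ} {f : Fin k → ℤ[X]} (hf : IsBatemanHornSystem f)
    {u : ℝ} (hu : 2 < u) :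
    ∀ᶠ x : ℕ in atTop, ∀ i, level (thetaKU k u) x < sieveBound f u x i := by
  have hu0 : 0 < u := by linarith
  filter_upwards [eventually_ge_atTop 2] with x hx i
  have hx1 : (1 : ℝ) < x := by exact_mod_cast hx
  have hθ := thetaKU_lt_inv k hu0
  have hdeg : (1 : ℝ) / u ≤ ((f i).natDegree : ℝ) / u := by
    have : (1 : ℝ) ≤ (f i).natDegree := by exact_mod_cast hf.natDegree_pos i
    exact div_le_div_of_nonneg_right this hu0.le
  have hlt : (x : ℝ) ^ thetaKU k u < (x : ℝ) ^ (((f i).natDegree : ℝ) / u) :=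
    Real.rpow_lt_rpow_of_exponent_lt hx1 (lt_of_lt_of_le hθ hdeg)
  unfold level sieveBound
  have h1 : ((⌊(x : ℝ) ^ thetaKU k u⌋₊ : ℕ) : ℝ) ≤ (x : ℝ) ^ thetaKU k u :=
    Nat.floor_le (by positivity)
  have h2 : (x : ℝ) ^ (((f i).natDegree : ℝ) / u) ≤ ((⌈(x : ℝ) ^ (((f i).natDegree : ℝ) / u)⌉₊ : ℕ) : ℝ) :=
    Nat.le_ceil _
  exact_mod_cast lt_of_le_of_lt h1 (lt_of_lt_of_le hlt h2)

/-- Eventually `log x ≤ (2/θ)·log ⌊x^θ⌋` (`θ > 0`): the level has logarithm comparable to `log x`. -/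
theorem eventually_log_le_mul_log_level {θ : ℝ} (hθ : 0 < θ) :
    ∀ᶠ x : ℕ in atTop, Real.log x ≤ (2 / θ) * Real.log (level θ x) ∧ 0 < Real.log (level θ x) := by
  -- eventually `x^θ ≥ 4`, so `D ≥ x^θ − 1 ≥ x^θ/2 ≥ 2` and `log D ≥ θ log x − log 2 ≥ (θ/2) log x`
  have hev : ∀ᶠ x : ℕ in atTop, (4 : ℝ) ≤ (x : ℝ) ^ θ :=
    ((tendsto_rpow_atTop hθ).comp tendsto_natCast_atTop_atTop).eventually_ge_atTop 4
  filter_upwards [hev, eventually_ge_atTop 1] with x hx hx1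
  have hx0 : (0 : ℝ) < x := by exact_mod_cast hx1
  set D : ℕ := level θ x with hD
  have hDge : (x : ℝ) ^ θ / 2 ≤ (D : ℝ) := by
    have hfl : (x : ℝ) ^ θ - 1 < (D : ℝ) := by
      rw [hD, level]; exact Nat.sub_one_lt_floor _
    linarith
  have hD2 : (2 : ℝ) ≤ (D : ℝ) := by linarith
  have hDpos : (0 : ℝ) < D := by linarith
  have hlogD : Real.log ((x : ℝ) ^ θ / 2) ≤ Real.log D := Real.log_le_log (by positivity) hDge
  rw [Real.log_div (by positivity) (by norm_num), Real.log_rpow hx0] at hlogD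
  have hlog2 : Real.log 2 ≤ θ * Real.log x / 2 := by
    -- from `4 ≤ x^θ`: `log 4 = 2 log 2 ≤ θ log x`
    have h4 : Real.log 4 ≤ Real.log ((x : ℝ) ^ θ) := Real.log_le_log (by norm_num) hx
    rw [Real.log_rpow hx0] at h4
    have : Real.log 4 = 2 * Real.log 2 := by
      rw [show (4 : ℝ) = 2 ^ 2 by norm_num, Real.log_pow]; norm_num
    linarith
  constructor
  · have : θ * Real.log x / 2 ≤ Real.log D := by linarith
    rw [div_mul_eq_mul_div, le_div_iff₀ hθ]
    linarith
  · exact Real.log_pos (by linarith)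

/-- S2b (registered, unfolded) is DEFINITIONALLY `truncSingularSum f D · (log D)^k → 0`. -/
theorem truncatedSingularSeries_iff :
    (∀ (k : ℕ) (f : Fin k → ℤ[X]), IsBatemanHornSystem f → 0 < k →
        Tendsto (fun D : ℕ => truncSingularSum f D * Real.log D ^ k) atTop (𝓝 0)) ↔
      ∀ (k : ℕ) (f : Fin k → ℤ[X]), IsBatemanHornSystem f → 0 < k →
        Tendsto (fun D : ℕ =>
          (∑ d ∈ (Fintype.piFinset fun _ : Fin k => Icc 1 D) with (∏ i, d i) ≤ D,
              (∏ i, (ArithmeticFunction.moebius (d i) : ℝ)) *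
                ((#((range (∏ i, d i)).filter
                    (fun r : ℕ => ∀ i, ((d i : ℕ) : ℤ) ∣ (f i).eval (r : ℤ))) : ℕ) : ℝ) /
                (∏ i, ((d i : ℕ) : ℝ))) * Real.log D ^ k)
          atTop (𝓝 0) :=
  Iff.rfl

/-- The truncated singular series of the EMPTY system is `1` (for `D ≥ 1`). -/
theorem truncSingularSum_fin_zero (f : Fin 0 → ℤ[X]) {D : ℕ} (hD : 1 ≤ D) :
    truncSingularSum f D = 1 := by
  unfold truncSingularSum tupleSet₀ densityTerm rhoTuple
  simp [Fintype.piFinset_of_isEmpty, Finset.filter_true_of_mem, hD]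

/-- **The density sum along the composition's level tends to a limit** (`0` for `k ≥ 1` by S2b,
`1` for `k = 0`), after the crux's `(log x)^k` normalisation. -/
theorem densitySum_mul_log_pow_tendsto
    (hS : ∀ (k : ℕ) (f : Fin k → ℤ[X]), IsBatemanHornSystem f → 0 < k →
      Tendsto (fun D : ℕ => truncSingularSum f D * Real.log D ^ k) atTop (𝓝 0))
    {k : ℕ} {f : Fin k → ℤ[X]} (hf : IsBatemanHornSystem f) {u : ℝ} (hu : 2 < u) :
    ∃ M : ℝ, Tendsto (fun x : ℕ =>
      densitySum f (sieveBound f u x) (level (thetaKU k u) x) * Real.log x ^ k) atTop (𝓝 M) := by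
  set θ : ℝ := thetaKU k u with hθdef
  have hθ : 0 < θ := thetaKU_pos k (by linarith)
  have hvac := eventually_level_lt_sieveBound hf hu
  rcases Nat.eq_zero_or_pos k with hk | hk
  · -- empty system: the density sum is identically 1 eventually
    subst hk
    refine ⟨1, tendsto_const_nhds.congr' ?_⟩
    filter_upwards [hvac, (tendsto_level_atTop hθ).eventually_ge_atTop 1] with x hx hD
    rw [densitySum_eq_truncSingularSum f hx, pow_zero, mul_one, truncSingularSum_fin_zero f hD]
  · refine ⟨0, ?_⟩
    have hlim : Tendsto (fun x : ℕ => truncSingularSum f (level θ x) * Real.log (level θ x) ^ k)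
        atTop (𝓝 0) := (hS k f hf hk).comp (tendsto_level_atTop hθ)
    -- `|S(D)·(log x)^k| ≤ (2/θ)^k · |S(D)·(log D)^k|`
    have hbound := (hlim.abs.const_mul ((2 / θ) ^ k))
    simp only [abs_zero, mul_zero] at hbound
    refine squeeze_zero_norm' ?_ hbound
    filter_upwards [hvac, eventually_log_le_mul_log_level hθ, eventually_ge_atTop 1] with x hx hlog hx1
    rw [Real.norm_eq_abs, densitySum_eq_truncSingularSum f hx, abs_mul, abs_mul]
    have hlogx : 0 ≤ Real.log x := Real.log_nonneg (by exact_mod_cast hx1)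
    have hratio : |Real.log x ^ k| ≤ (2 / θ) ^ k * |Real.log (level θ x) ^ k| := by
      rw [abs_of_nonneg (pow_nonneg hlogx k), abs_of_nonneg (pow_nonneg hlog.2.le k), ← mul_pow]
      exact pow_le_pow_left₀ hlogx hlog.1 k
    calc |truncSingularSum f (level θ x)| * |Real.log x ^ k|
        ≤ |truncSingularSum f (level θ x)| * ((2 / θ) ^ k * |Real.log (level θ x) ^ k|) :=
          mul_le_mul_of_nonneg_left hratio (abs_nonneg _)
      _ = (2 / θ) ^ k * (|truncSingularSum f (level θ x)| * |Real.log (level θ x) ^ k|) := by ring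

/-- **S2 from S2a + S2b + S2c (v4).**  The level-`x^{θ_{k,u}}` Type-I part converges after
normalisation (to the limit of the density sum: `0` for `k ≥ 1`, `1` for `k = 0`). -/
theorem typeILimit_of_parts
    (hS : ∀ (k : ℕ) (f : Fin k → ℤ[X]), IsBatemanHornSystem f → 0 < k →
      Tendsto (fun D : ℕ => truncSingularSum f D * Real.log D ^ k) atTop (𝓝 0)) :
    TypeILimitBelow := by
  intro k f hf u hu
  obtain ⟨M, hM⟩ := densitySum_mul_log_pow_tendsto hS hf hu
  refine ⟨M, ?_⟩
  obtain ⟨n₀, hn₀⟩ := IncrementAnchoring.SieveBand.exists_forall_eval_pos hf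
  refine hM.congr_dist ?_
  have hrem := tendsto_remainder_zero k n₀ hu
  refine squeeze_zero' (Eventually.of_forall fun x => dist_nonneg) ?_ hrem
  filter_upwards [eventually_ge_atTop 1] with x hx
  have hx0 : (0 : ℝ) < x := by exact_mod_cast hx
  rw [Real.dist_eq, typeINorm]
  set θ : ℝ := thetaKU k u
  have hb := abs_typeISum_sub_densitySum_le f u θ x hn₀
  have hlog : 0 ≤ Real.log x ^ k := pow_nonneg (Real.log_nonneg (by exact_mod_cast hx)) k
  calc |densitySum f (sieveBound f u x) (level θ x) * Real.log x ^ k -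
        (typeISum f u θ x : ℝ) * Real.log x ^ k / (x : ℝ)|
      = |(typeISum f u θ x : ℝ) - (x : ℝ) * densitySum f (sieveBound f u x) (level θ x)| *
          Real.log x ^ k / (x : ℝ) := by
        rw [show densitySum f (sieveBound f u x) (level θ x) * Real.log x ^ k -
            (typeISum f u θ x : ℝ) * Real.log x ^ k / (x : ℝ) =
            -(((typeISum f u θ x : ℝ) - (x : ℝ) * densitySum f (sieveBound f u x) (level θ x)) *
              Real.log x ^ k / (x : ℝ)) by field_simp; ring]
        rw [abs_neg, abs_div, abs_mul, abs_of_nonneg hlog, abs_of_pos hx0]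
    _ ≤ ((level θ x : ℕ) : ℝ) ^ k * ((n₀ : ℝ) + (level θ x : ℕ)) * Real.log x ^ k / (x : ℝ) := by
        gcongr

/-- S2 (`TypeILimitBelow`, v3/v4: no longer a stub) from the registered S2b via the reduction
(S2a and S2c enter through `typeISum_eq_sum_tupleSet` / `abs_congCount_sub_le`). -/
theorem typeILimitBelow_of_stub : TypeILimitBelow :=
  typeILimit_of_parts (truncatedSingularSeries_iff.mpr stub_truncatedSingularSeries)

/-- **THE COMPOSITION.**  `RoughValueLaw` BY NAME from the stubs S1, S2, S3 (sorry only inside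
`stub_*`). -/
theorem RoughValueLaw_of : RoughValueLaw :=
  roughValueLaw_iff.mpr
    (systemRoughValueLaw_of_parts friableDecomposition_of_stub typeILimitBelow_of_stub
      stub_deepTailComplement)

/-- **Honesty certificate (converse transfer)**: the residual S3 is implied by the crux's conclusion
with the expected constant, given S1 + S2 — so S3 neither weakens nor (beyond pinning `A`)
strengthens the crux: it is exactly its non-Type-I content. -/
theorem deepTailComplement_of_pinnedLaw (h₁ : FriableDecomposition)
    (hlaw : ∀ (k : ℕ) (f : Fin k → ℤ[X]), IsBatemanHornSystem f → ∀ ω : ℝ → ℝ, IsBuchstab ω →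
      ∀ u : ℝ, 2 < u → Tendsto (roughNorm f u) atTop (𝓝 (bhA f * (u * ω u) ^ k))) :
    DeepTailComplement := by
  intro k f hf ω hω u θ hu _ _ M hM
  have hlim := (hlaw k f hf ω hω u hu).sub hM
  refine hlim.congr fun x => ?_
  rw [roughNorm_eq h₁ f u θ x]
  ring

/-- **The residual IS the pinned crux (honesty certificate as an `iff`).**  Given the identity S1
and the Type-I limit S2 (at `θ_k`), the residual statement `DeepTailComplement` (S3, quantified
over every level `0 < θ < 1`) is EQUIVALENT to the crux's conclusion for every system with the
constant pinned to `A = C(f)/∏ deg fᵢ`.  (`→`: instantiate at `θ_k` and add the two limits;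
`←`: subtract, at any `θ`.)  This is what a `promote-stub` of S3 hands back: RoughValueLaw itself,
with its constant identified, nothing weaker and nothing stronger. -/
theorem deepTailComplement_iff_pinnedLaw (h₁ : FriableDecomposition) (h₂ : TypeILimitBelow) :
    DeepTailComplement ↔
      ∀ (k : ℕ) (f : Fin k → ℤ[X]), IsBatemanHornSystem f → ∀ ω : ℝ → ℝ, IsBuchstab ω →
        ∀ u : ℝ, 2 < u → Tendsto (roughNorm f u) atTop (𝓝 (bhA f * (u * ω u) ^ k)) := by
  refine ⟨fun h₃ k f hf ω hω u hu => ?_, deepTailComplement_of_pinnedLaw h₁⟩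
  obtain ⟨M, hM⟩ := h₂ k f hf u hu
  have hT := h₃ k f hf ω hω u (thetaKU k u) hu (thetaKU_pos k (by linarith))
    (thetaKU_lt_one k hu) M hM
  have hsum := hM.add hT
  have hval : M + (bhA f * (u * ω u) ^ k - M) = bhA f * (u * ω u) ^ k := by ring
  rw [hval] at hsum
  exact hsum.congr fun x => (roughNorm_eq h₁ f u (thetaKU k u) x).symm

/-! ## §5 Beyond `x` (sorry-free): the level push moves the residual to `DeepTailBeyond` -/

/-- **S1–S4 ⟹ DeepTailBeyond** for every BH quadratic: the deep tail beyond `x` is what remains. -/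
theorem deepTailBeyond_of_parts (h₁ : FriableDecomposition) (h₂ : TypeILimitBelow)
    (h₃ : DeepTailComplement) (h₄ : TypeILevelPush) :
    ∀ f : ℤ[X], IsBatemanHornSystem ![f] → f.natDegree = 2 → DeepTailBeyond f := by
  intro f hf hdeg ω hω
  obtain ⟨u₀, hu₀, H⟩ := h₄ f hf hdeg ω hω
  refine ⟨u₀, hu₀, fun u hu => ?_⟩
  obtain ⟨δ₀, hδ₀, Hδ⟩ := H u hu
  refine ⟨δ₀, hδ₀, fun δ hδ hδle => ?_⟩
  have hu2 : 2 < u := by linarith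
  obtain ⟨M, hM⟩ := h₂ 1 ![f] hf u hu2
  have hT := h₃ 1 ![f] hf ω hω u (thetaKU 1 u) hu2 (thetaKU_pos 1 (by linarith))
    (thetaKU_lt_one 1 hu2) M hM
  have hP := Hδ δ hδ hδle
  have hlim := (hM.add hT).sub hP
  have hval : M + (bhA ![f] * (u * ω u) ^ 1 - M) - bhA ![f] * (u * ω ((1 + δ) * u / 2)) =
      bhA ![f] * (u * ω u - u * ω ((1 + δ) * u / 2)) := by ring
  rw [hval] at hlim
  refine hlim.congr fun x => ?_
  have e₁ := roughNorm_eq h₁ ![f] u (thetaKU 1 u) x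
  have e₂ := roughNorm_eq h₁ ![f] u (1 + δ) x
  linarith

/-- **S1 + S4 + DeepTailBeyond f ⟹ the crux's conclusion for `![f]` on the rungs `u ≥ u₀`**, with the
forced constant `A = C(f)/2`: after the level push, the ε-parity statement `DeepTailBeyond f` is ALL
that the quadratic rungs `u ≥ u₀` of the crux require. -/
theorem largeDepthRoughValueLaw_of_parts (h₁ : FriableDecomposition) (h₄ : TypeILevelPush)
    (f : ℤ[X]) (hf : IsBatemanHornSystem ![f]) (hdeg : f.natDegree = 2) (h₅ : DeepTailBeyond f) :
    LargeDepthRoughValueLaw ![f] := by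
  intro ω hω
  obtain ⟨u₀, hu₀, H⟩ := h₄ f hf hdeg ω hω
  obtain ⟨u₁, hu₁, H'⟩ := h₅ ω hω
  refine ⟨max u₀ u₁, fun u hu => ?_⟩
  obtain ⟨δ₀, hδ₀, Hδ⟩ := H u ((le_max_left _ _).trans hu)
  obtain ⟨δ₁, hδ₁, Hδ'⟩ := H' u ((le_max_right _ _).trans hu)
  set δ : ℝ := min δ₀ δ₁ with hδdef
  have hδ : 0 < δ := lt_min hδ₀ hδ₁
  have hP := Hδ δ hδ (min_le_left _ _)
  have hT := Hδ' δ hδ (min_le_right _ _)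
  have hlim := hP.add hT
  have hval : bhA ![f] * (u * ω ((1 + δ) * u / 2)) +
      bhA ![f] * (u * ω u - u * ω ((1 + δ) * u / 2)) = bhA ![f] * (u * ω u) ^ 1 := by ring
  rw [hval] at hlim
  refine hlim.congr fun x => ?_
  exact (roughNorm_eq h₁ ![f] u (1 + δ) x).symm

/-- The pinned constant for a single polynomial: `bhA ![f] = C(f)/deg f` (`= C(f)/2` for a quadratic). -/
theorem bhA_single (f : ℤ[X]) : bhA ![f] = batemanHornConst ![f] / (f.natDegree : ℝ) := by
  simp [bhA]

/-- Instantiated with the stubs: every BH quadratic has `DeepTailBeyond` modulo S1–S4 … -/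
theorem deepTailBeyond_quadratic (f : ℤ[X]) (hf : IsBatemanHornSystem ![f])
    (hdeg : f.natDegree = 2) : DeepTailBeyond f :=
  deepTailBeyond_of_parts friableDecomposition_of_stub typeILimitBelow_of_stub
    stub_deepTailComplement stub_typeILevelPush f hf hdeg

/-- … and conversely `DeepTailBeyond f` gives its rungs `u ≥ u₀` modulo S1 + S4 only (no S2, no S3):
e.g. for `n² + 1` (`isBatemanHornSystem_X_sq_add_one`). -/
theorem largeDepthRoughValueLaw_quadratic (f : ℤ[X]) (hf : IsBatemanHornSystem ![f])
    (hdeg : f.natDegree = 2) (h₅ : DeepTailBeyond f) : LargeDepthRoughValueLaw ![f] :=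
  largeDepthRoughValueLaw_of_parts friableDecomposition_of_stub stub_typeILevelPush f hf hdeg h₅

/-- The `n² + 1` instance: its rungs `u ≥ u₀` with `A = 𝔖/2` (`hardyLittlewoodEConst/2`) follow from
S1, S4 and the ε-parity statement `DeepTailBeyond (X²+1)`. -/
theorem largeDepthRoughValueLaw_X_sq_add_one (h₅ : DeepTailBeyond (X ^ 2 + 1 : ℤ[X])) :
    LargeDepthRoughValueLaw ![(X ^ 2 + 1 : ℤ[X])] :=
  largeDepthRoughValueLaw_quadratic _ isBatemanHornSystem_X_sq_add_one
    (by
      have h : (X ^ 2 + 1 : ℤ[X]) = C 1 * X ^ 2 + C 0 * X + C 1 := by simp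
      rw [h]; exact Polynomial.natDegree_quadratic one_ne_zero)
    h₅

end Summit.Parity.BatemanHorn.Cruxes.RoughValueLaw.FriableDeepTail
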